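import Literature.MathematicalPhysics.QuantumFieldTheory.Balaban1983to89.B3Ineq210MixedRegularTorus
import Literature.MathematicalPhysics.QuantumFieldTheory.Balaban1983to89.B3GkZeroBoxSeparated
import Literature.MathematicalPhysics.QuantumFieldTheory.Balaban1983to89.B3Sect3Statements
import Literature.MathematicalPhysics.QuantumFieldTheory.Balaban1983to89.B3Sect1Statements

/-!
# Bałaban, *(Higgs)₂,₃ quantum fields in a finite volume III. Renormalization* [B3] — (3.1) p. 432,
`‖hG_k(Ω,B̃)h′‖_{1,α} ≤ O(1)e^{−δ₀dist(□(v),□(v′))}`, AT A REGULAR NON-CONSTANT BACKGROUND `B̃ = A` ON THE TORUS `Ω = T_η`, PROVED for a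
concrete carrier of `B3Sect3Statements.Sect3Data` (the decl of record `Sect3Data.Ineq31 α δ₀ C` of row B3.Eq3.1, per `0 ≤ α < 1`)

statement-level skeleton of published theorems with citation tags; proofs where landed; nothing here is a claim about the Yang–Mills mass gap

T. Bałaban, Commun. Math. Phys. **88** (1983) 411–445 [cite: Balaban1983Higgs3]; inputs from part I, Commun. Math. Phys. **85** (1982)
603–636 [cite: Balaban1982Higgs1] as landed in the tree.  PDF held: `paper:balaban1983-higgs-2-3-quantum-fields-finite-volume` (journal page =
PDF page + 410), p. 420 [PDF 10] (`p0010.txt`), p. 424 [PDF 14], p. 426 [PDF 16], p. 432 [PDF 22] (`p0022.txt`).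

CITATION HEADER (lean-in-tree rule).  Cell `lit-balaban` (HOME `run/shared/lean/pub/lit-balaban/`), Phase-2 proof seat **p40** gen 68 (unit
`lit-balaban-p40`); SKELETON row **B3.Eq3.1** (fold owner r15, `B3-CLOSURE.md` §5 item 5 «(3.1) at regular B̃ free»; decl of record
`B3Sect3Statements.Sect3Data.Ineq31`).  REGULAR-BACKGROUND TWIN of p03's `B3Ineq31ZeroTorus` (the same row at `B̃ = 0`, where the transports
are identities); file 2 of 2 (file 1 = `B3Ineq210MixedRegularTorus`, p341241, the twice-differentiated clause of (2.10)).  USED BY NAME, never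
restated: r14's (2.10) at a regular background `B3Ineq210RegularTorus.ineq210_regularTorus` (p339501) with its pieces `pieceA`/`sum_pieceA`
((2.6)) and carrier `regTorusKernels`; p26's (2.11) `B3Ineq211RegularTorus.ineq211At_regularTorus` (p340301) with `holderTerm`, the admissible
contours `IsAdm`/`legs` and `holderTerm_le_holderDiff`; file 1's `ineq210_mixed_regularTorus`, `mixedTerm`, `dip`, `norm_covDeriv_dip_le_sum`,
`inner_covDeriv_propagatorK_single`; p35's chain transport `B1TorusChainTransport.hol`/`norm_hol_apply_sub_le` (the path lemma); p03's real-variable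
scale sum `B3GkZeroBoxSeparated.scaleSum_sep_le`; the printed SUM form of (1.32) `B3Sect1Statements.norm132` over `LatticeNorms.supNorm`/
`holderSeminorm`; the typer's `HiggsLattice`/`HiggsCovariance.propagatorK`/`kernel`.

## What is printed (verbatim)

p. 432 [PDF 22]: *"Now if two vertices, v, v′ have localizations satisfying dist(□(v), □(v′)) ≥ 1, then we consider every propagator
corresponding to a line connecting these vertices as an external field also. Such a possibility is assured by the following estimates
‖hG_k(Ω, B̃)h′‖_{1,α} ≤ O(1)e^{−δ₀dist(□(v),□(v′))}, (3.1) and similarly for the vector field propagator, h, h′ are localization functions."*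
p. 420 [PDF 10]: *"For a scalar field f of one variable we define ‖f‖_{1,α} = sup_x|f(x)| + sup_{x,μ}|(D^η_{B̃,μ}f)(x)| +
sup_{x,x′,μ} |x − x′|^{−α}|U(B̃(Γ_{x,x′}))(D^η_{B̃,μ}f)(x′) − (D^η_{B̃,μ}f)(x)|, (1.32) where Γ_{x,x′} is a shortest contour connecting x and x′.
This definition extends in a natural way to functions of many variables."*  The localizations `h, h′` are (the characteristic functions of)
unit cubes `□(v)` of the `η`-lattice (p. 420: *"we localize simply by representing Ω₁ as a sum of unit cubes"*).

## What this file proves (`ineq31_regularTorus`), and how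

THE READING OF (1.32) FOR THE TWO-VARIABLE FIELD `F(x,x′) = G_k(T_η,A;x,x′) ∈ Hom(ℝ^N_{x′}, ℝ^N_x)` on `□(v) × □(v′)` (§6): values = the
`N × N` blocks with the operator norm, in the print's units for the step `k` (`unitV = (L^kε)^{d−2}ε^{−d}`); covariant derivatives along the
`2d` directions of the product lattice — `D^η_{A,μ}` in `x` on row bonds, `D^η_{A,ν}` in `x′` on column bonds (a column derivative is the row
derivative of the transposed kernel, by the symmetry `G_k(x,x′)^* = G_k(x′,x)`), unit `unitD = (L^kε)^{d−1}ε^{−d}`; the Hölder quotient over ALL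
same-direction pairs of product bonds of the domain at positive sup-distance `|z − z′|/L^k` of their base points (no restriction `≤ 1`, as
printed), with the transport `M ↦ U(A(Γ))∘M∘U(A(Γ′))^*` along the coordinatewise shortest contours `cpath` in BOTH variables; assembled by the
printed SUM `norm132`.  The carrier `sect3RegTorus S C A m² a k : Sect3Data` has `LocFn = T_1^{(k)}` (cube labels), `distCubes = max(|v−v′|−1, 0)`,
this `normHGH`, and EMPTY renormalization classes (`RenClass′ = PEmpty`: (3.2)–(3.5) are not modelled and nothing is claimed about them).

THE THEOREM: for the torus family (`d`, odd `L > 1`; `S : Shape P`, `K₀ ∣ M`, `3K₀ ≤ 2M`, `K₀ ≥ K₀min`), `m² > 0`, `a > 0`, charge data `C`,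
every `0 ≤ α < 1` has `t, δ₀, C > 0` (functions of `K₀`) with: for all `1 ≤ k ≤ K`, `L^kε ≤ 1`, all `A` with `L^k·sup|∂A|·|e| ≤ t(K₀)` ((2.23)),
`(sect3RegTorus S C A m² a k).Ineq31 α (δ₀ K₀) (C K₀)`, i.e. `‖hG_k(T_η,A)h′‖_{1,α} ≤ C e^{−δ₀dist(□(v),□(v′))}` whenever `dist ≥ 1`.

THE ROUTE (the print's "rescaling … and application of Propositions I.2.1 and I.2.3", through the pieces (2.6)): §1 cube geometry —
points of cubes at distance `D ≥ 1` are `≥ L^kD + 1` apart (`sep_of_cubes`), a cube has diameter `≤ L^k − 1`, and p26's coordinatewise contour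
between two points of a cube STAYS IN THE CUBE (`mem_leg_coords`, `blockIter_eq_of_mem_legs`; needed because the column transport must not leave
`□(v′)`); §2 the scale sum `Σ_{j<k}(L^{k−j})^p e^{−δD L^{k−j}} ≤ Φ_p(δ,L)e^{−(δL/2)D}` (p03); §3 `G_k = Σ_j G^η_{(j)}` below the pieces for values, row
derivatives and transported row differences; §4 r14's `Ineq210` and p26's `Ineq211At` read back as kernel bounds in the model's units; §5 the
blocks as continuous maps, `‖block‖ ≤` column sums, and THE COLUMN MOVE (`norm_blockDK_comp_star_sub_le`): the adjoint identity
`⟨w,(DG_kδ_yv)(b)⟩ = ε^{−1}⟨(G_k dip_b w)(y), v⟩` makes `(DG_k)(b,y₂)U(A(Γ′))^* − (DG_k)(b,y₁)` the transported difference of the column field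
`ψ = ε^{−1}G_k dip_b w` along `Γ′ ⊂ □(v′)`, bounded by p35's path lemma through `sup_{□(v′)}|D_Aψ|`, i.e. through the MIXED clause of (2.10)
(file 1); §7 the three parts: kernel (value clause, weight `(L^{k−j})^{d−2}`), derivatives (`(L^{k−j})^{d−1}`), Hölder = triangle through
`(DG_k)(⟨x₂,μ⟩,y₁)`: column move `≤ d·(|y₁−y₂|/L^k)·C_MΦE ≤ d·p^α·C_MΦE` (`p = |z−z′|/L^k ≤ 1` inside unit cubes, so `p ≤ p^α`) plus row move by
(2.11) along `Γ_{x₁,x₂}` (`(ε|x₁−x₂|)^α(L^jε)^{−α} = (p_x L^{k−j})^α ≤ p^α L^{k−j}`); all weights `≤ (L^{k−j})^{d+1}`; §8 the constants: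
`δ = min(δ₁,δ₂,δ₃)` of the three inputs, `δ₀ = δL/2`, `C = (2C_V + C_H + dC_M)·Φ_{d+1}(δ,L)`, `t = min`, `K₀min = max`.

## Honest scope

`Ω = T_η` only (no region `Ω ⊂ T_η`, no `∂Ω`, no `δG_k` — those are (2.5)/(1.16), B4-side); the scalar propagator only ("similarly for the
vector field propagator" is p03's `B3Ineq212ZeroTorus`, background-free); `m² > 0`; the `Shape` sub-family (`L` odd `> 1`) tiled by `K₀`-cubes;
the constants depend on `α` AND on `K₀` as in the cited inputs (GAPS G-B3-11: the print's `O(1), δ₀` are uniform); localization functions =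
sharp unit cubes `□(v)`, `v ∈ T_1^{(k)}` (blocks `⌊x/L^k⌋ = v` of the fine torus), not a smooth partition; `|·|` of a block = operator norm on
`ℝ^N → ℝ^N`; contours = the fixed coordinatewise shortest paths `cpath` (admissible in p26's sense, length `≤ d|x−x′|`; the print's "a shortest
contour").  Non-vacuity of the hypotheses: r14's `B3Ineq210RegularTorus.regularTorus_hypotheses_nonvacuous` (same hypotheses, `A = 0`
admissible), p26's `exists_isAdm`.  No `def … : Prop`, no new named fact (all `def`s here are concrete data: cubes, contours, blocks, the
carrier); axioms standard.  Value = kernel certificate of one located estimate of B3 §3 at a regular background on the torus, NOT summit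
progress.
-/

noncomputable section

open scoped BigOperators InnerProductSpace Matrix

namespace Literature.MathematicalPhysics.QuantumFieldTheory.Balaban1983to89.B3Ineq31RegularTorus

open HiggsLattice (ChargeData ScalarField siteInner covDeriv)
open HiggsCovariance (propagatorK E)
open HiggsAveraging (blockIter)
open B1Eq230FluctCov (Ix cb)
open B1Ineq234Concrete (val_blockIter_all tdist_blockIter_le_real tdist_self nCol)
open B1Ineq234LevelZero (tdist_comm tdist_triangle_real tdist_shift_le_one)
open B1TorusChainTransport (IsTChain hol norm_hol_apply norm_hol_apply_sub_le hol_nil)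
open B4GaugeCovariance (pathEnd)
open B2Restr216Lattice (norm_U_apply)
open B1Eq211ZeroFieldTorus (Shape)
open B3Sect2StatementsPart2 (ScaledKernels)
open B3Sect3Statements (Sect3Data)
open B3Sect1Statements (norm132 norm132_nonneg)
open LatticeNorms (supNorm holderSeminorm supNorm_le holderSeminorm_le supNorm_nonneg holderSeminorm_nonneg)
open B4Thm110ZeroBox (sc sc_pos)
open B3GkZeroBoxSeparated (scaleSum_sep_le)
open B3Ineq210RegularTorus
open B3Ineq211RegularTorus (IsAdm holderTerm holderTerm_le_holderDiff legs leg stepsFwd stepsBwd isTChain_legs pathEnd_legs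
  length_legs_le regTorusKernelsH ineq211At_regularTorus)
open B3Ineq210MixedRegularTorus

variable {P : HiggsLattice.Params} {N : ℕ}

/-! ## §1 The unit cubes `□(v)`, `v ∈ T_1^{(k)}`, of the fine torus; separation of two cubes; a cube is path-connected by the
coordinatewise shortest lattice paths -/

section Geometry

variable {k : ℕ}

/-- `dist(□(v), □(v′))` for the closed unit cubes of `T_1^{(k)}` over `v, v′` (sup torus distance (I.1.3) of the `k`-blocks):
`max(|v − v′|_{T^{(k)}} − 1, 0)`. [cite: Balaban1983Higgs3, (3.1) p.432] -/
def cubeDist (k : ℕ) (v v' : HiggsLattice.Site P k) : ℝ := max ((HiggsLattice.Site.tdist v v' : ℝ) - 1) 0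

/-- `dist(□(v), □(v′)) ≥ 0`. [cite: Balaban1983Higgs3, (3.1) p.432] -/
theorem cubeDist_nonneg (v v' : HiggsLattice.Site P k) : 0 ≤ cubeDist k v v' := le_max_right _ _

/-- `dist(□(v), □(v′))` is symmetric. [cite: Balaban1983Higgs3, (3.1) p.432] -/
theorem cubeDist_comm (v v' : HiggsLattice.Site P k) : cubeDist k v v' = cubeDist k v' v := by
  unfold cubeDist; rw [tdist_comm]

/-- **Points of two unit cubes are separated by the cube distance**: for fine sites `x ∈ □(v)`, `x′ ∈ □(v′)` (`⌊x/L^k⌋ = v`) with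
`dist(□(v),□(v′)) ≥ 1`: `L^k·dist(□(v),□(v′)) + 1 ≤ |x − x′|` (in fine lattice units; `B1Ineq234Concrete.tdist_blockIter_le_real`).
[cite: Balaban1983Higgs3, (3.1) p.432] [cite: Balaban1982Higgs1, (1.20) p.607] -/
theorem sep_of_cubes (hk : k ≤ P.K) {x x' : HiggsLattice.Site P 0} {v v' : HiggsLattice.Site P k} (hx : blockIter k x = v)
    (hx' : blockIter k x' = v') (h1 : 1 ≤ cubeDist k v v') :
    (P.L : ℝ) ^ k * cubeDist k v v' + 1 ≤ (HiggsLattice.Site.tdist x x' : ℝ) := by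
  have hT : (0 : ℝ) < (P.L : ℝ) ^ k := pow_pos (by exact_mod_cast P.hL) k
  have h := tdist_blockIter_le_real hk x x'
  rw [hx, hx'] at h
  have hcd : cubeDist k v v' = (HiggsLattice.Site.tdist v v' : ℝ) - 1 := by
    unfold cubeDist at h1 ⊢
    rcases le_total ((HiggsLattice.Site.tdist v v' : ℝ) - 1) 0 with h0 | h0
    · rw [max_eq_right h0] at h1; norm_num at h1
    · rw [max_eq_left h0]
  rw [hcd]
  have e : (P.L : ℝ) ^ k * ((HiggsLattice.Site.tdist x x' : ℝ) / (P.L : ℝ) ^ k + 1 - ((P.L : ℝ) ^ k)⁻¹)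
      = (HiggsLattice.Site.tdist x x' : ℝ) + (P.L : ℝ) ^ k - 1 := by
    field_simp
  nlinarith [mul_le_mul_of_nonneg_left h hT.le]

/-- Hence, in the print's units for the step `k` (`η = L^{−k}`): `D := |x − x′|/L^k ≥ dist(□(v),□(v′)) ≥ 1`.
[cite: Balaban1983Higgs3, (3.1) p.432] -/
theorem cubeDist_le_sepD (hk : k ≤ P.K) {x x' : HiggsLattice.Site P 0} {v v' : HiggsLattice.Site P k} (hx : blockIter k x = v)
    (hx' : blockIter k x' = v') (h1 : 1 ≤ cubeDist k v v') :
    cubeDist k v v' ≤ (HiggsLattice.Site.tdist x x' : ℝ) / (P.L : ℝ) ^ k := by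
  have hT : (0 : ℝ) < (P.L : ℝ) ^ k := pow_pos (by exact_mod_cast P.hL) k
  rw [le_div_iff₀ hT]
  have h := sep_of_cubes hk hx hx' h1
  nlinarith

/-- Two points of one unit cube are at fine distance `≤ L^k − 1` (`B3Ineq210RegularTorus.tdist_le_pow_mul_tdist_blockIter`).
[cite: Balaban1982Higgs1, (1.20) p.607] -/
theorem tdist_le_of_same_cube (hk : k ≤ P.K) {y₁ y₂ : HiggsLattice.Site P 0} {v : HiggsLattice.Site P k} (h₁ : blockIter k y₁ = v)
    (h₂ : blockIter k y₂ = v) : (HiggsLattice.Site.tdist y₁ y₂ : ℝ) ≤ (P.L : ℝ) ^ k - 1 := by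
  have h := tdist_le_pow_mul_tdist_blockIter hk y₁ y₂
  rw [h₁, h₂, tdist_self, mul_zero, zero_add] at h
  have h1 : 1 ≤ P.L ^ k := Nat.one_le_pow _ _ P.hL
  have := (Nat.cast_le (α := ℝ)).mpr h
  rw [Nat.cast_sub h1, Nat.cast_pow, Nat.cast_one] at this
  exact this

/-- The tori of the family have more than two sites per direction at the finest level once `K ≥ 1`, `L ≥ 2`
(`|T_ε|_μ = 2L^KML′_μ ≥ 4`). [cite: Balaban1982Higgs1, (1.2) p.604] -/
theorem two_lt_sitesPerDir (hK : 1 ≤ P.K) (hL : 2 ≤ P.L) (μ : Fin P.d) : 2 < P.sitesPerDir 0 μ := by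
  unfold HiggsLattice.Params.sitesPerDir
  have h1 : 2 ≤ P.L ^ (P.K - 0) := by
    rw [Nat.sub_zero]
    calc 2 ≤ P.L := hL
      _ = P.L ^ 1 := (pow_one _).symm
      _ ≤ P.L ^ P.K := Nat.pow_le_pow_right P.hL hK
  have h2 := P.hM
  have h3 := P.hLp μ
  have : 1 ≤ P.M * P.Lp μ := Nat.one_le_iff_ne_zero.mpr (Nat.mul_ne_zero (by omega) (by omega))
  nlinarith

/-- `x ∈ □(v)` in coordinates: `⌊x_ν/L^k⌋ = v_ν` for every `ν`. [cite: Balaban1982Higgs1, (1.20) p.607] -/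
theorem blockIter_eq_iff (x : HiggsLattice.Site P 0) (v : HiggsLattice.Site P k) :
    blockIter k x = v ↔ ∀ ν : Fin P.d, (x ν).val / P.L ^ k = (v ν).val := by
  constructor
  · intro h ν; rw [← h, val_blockIter_all]
  · intro h; funext ν; apply ZMod.val_injective; rw [val_blockIter_all, h ν]

/-! ### The coordinatewise shortest lattice path between two points of a cube stays in the cube -/

/-- membership in `n` forward steps: `z = x + t·εe_μ`, `1 ≤ t ≤ n`. [cite: Balaban1982Higgs1, (1.2) p.604] -/
theorem mem_stepsFwd {μ : Fin P.d} : ∀ {x : HiggsLattice.Site P 0} {n : ℕ} {z : HiggsLattice.Site P 0},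
    z ∈ stepsFwd μ x n → ∃ t : ℕ, 1 ≤ t ∧ t ≤ n ∧ z = Function.update x μ (x μ + (t : ZMod (P.sitesPerDir 0 μ)))
  | x, 0, z, h => by simp [stepsFwd] at h
  | x, n + 1, z, h => by
    rw [stepsFwd, List.mem_cons] at h
    rcases h with rfl | h
    · exact ⟨1, le_rfl, by omega, by simp [HiggsLattice.Site.shift]⟩
    · obtain ⟨t, ht1, htn, rfl⟩ := mem_stepsFwd h
      refine ⟨t + 1, by omega, by omega, ?_⟩
      funext ν
      by_cases hν : ν = μ
      · subst hν
        simp only [HiggsLattice.Site.shift, Function.update_self, Nat.cast_add, Nat.cast_one]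
        ring
      · simp [HiggsLattice.Site.shift, Function.update_of_ne hν]

/-- membership in `n` backward steps: `z = x − t·εe_μ`, `1 ≤ t ≤ n`. [cite: Balaban1982Higgs1, (1.2) p.604] -/
theorem mem_stepsBwd {μ : Fin P.d} : ∀ {x : HiggsLattice.Site P 0} {n : ℕ} {z : HiggsLattice.Site P 0},
    z ∈ stepsBwd μ x n → ∃ t : ℕ, 1 ≤ t ∧ t ≤ n ∧ z = Function.update x μ (x μ - (t : ZMod (P.sitesPerDir 0 μ)))
  | x, 0, z, h => by simp [stepsBwd] at h
  | x, n + 1, z, h => by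
    rw [stepsBwd, List.mem_cons] at h
    rcases h with rfl | h
    · exact ⟨1, le_rfl, by omega, by simp [HiggsLattice.Site.unshift]⟩
    · obtain ⟨t, ht1, htn, rfl⟩ := mem_stepsBwd h
      refine ⟨t + 1, by omega, by omega, ?_⟩
      funext ν
      by_cases hν : ν = μ
      · subst hν
        simp only [HiggsLattice.Site.unshift, Function.update_self, Nat.cast_add, Nat.cast_one]
        ring
      · simp [HiggsLattice.Site.unshift, Function.update_of_ne hν]

/-- quotient squeeze: `qT ≤ m < qT + T` gives `⌊m/T⌋ = q`. [folklore] -/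
private theorem div_eq_of_mem {T q m : ℕ} (lo : q * T ≤ m) (hi : m < q * T + T) : m / T = q :=
  Nat.div_eq_of_lt_le lo (by rw [add_mul, one_mul]; exact hi)

/-- **One leg inside a cube**: if `x_μ` and `y_μ` have the same `k`-block label `q` (and `|T_ε|_μ ≥ 2L^k`), then every point of the
leg from `x` towards `y` in direction `μ` (p26's `leg`: the shorter arc, which is then the direct segment) has `μ`-label `q` and all
other coordinates those of `x`. [cite: Balaban1982Higgs1, (1.3) p.604, (1.20) p.607] -/
theorem mem_leg_coords {μ : Fin P.d} {x y : HiggsLattice.Site P 0} {q : ℕ} (hn : 2 * P.L ^ k ≤ P.sitesPerDir 0 μ)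
    (hx : (x μ).val / P.L ^ k = q) (hy : (y μ).val / P.L ^ k = q) {z : HiggsLattice.Site P 0} (hz : z ∈ leg x y μ) :
    (z μ).val / P.L ^ k = q ∧ ∀ ν, ν ≠ μ → z ν = x ν := by
  set n := P.sitesPerDir 0 μ with hn_def
  set T := P.L ^ k with hT_def
  have hT : 0 < T := pow_pos P.hL k
  set a := (x μ).val with ha
  set b := (y μ).val with hb
  have han : a < n := ZMod.val_lt _
  have hbn : b < n := ZMod.val_lt _
  -- both labels in `[qT, (q+1)T)`
  have ha1 : q * T ≤ a := by rw [← hx]; exact Nat.div_mul_le_self a T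
  have ha2 : a < q * T + T := by rw [← hx]; exact Nat.lt_div_mul_add hT
  have hb1 : q * T ≤ b := by rw [← hy]; exact Nat.div_mul_le_self b T
  have hb2 : b < q * T + T := by rw [← hy]; exact Nat.lt_div_mul_add hT
  -- the two arc lengths
  have hval_sub_xy : b ≤ a → (x μ - y μ).val = a - b := fun h => ZMod.val_sub h
  have hval_sub_yx : a ≤ b → (y μ - x μ).val = b - a := fun h => ZMod.val_sub h
  have hval_rev : ∀ {u w : ZMod n}, u ≠ w → (w - u).val = n - (u - w).val := fun {u w} h => by
    rw [← neg_sub, ZMod.neg_val, if_neg (sub_ne_zero.mpr h)]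
  unfold leg at hz
  split_ifs at hz with hcase
  · -- forward arc chosen: then `a ≤ b` (else the forward arc would be the long one)
    have hab : a ≤ b := by
      by_contra hlt
      push Not at hlt
      have hne : x μ ≠ y μ := fun e => by rw [ha, hb, e] at hlt; exact lt_irrefl _ hlt
      have h1 : (x μ - y μ).val = a - b := hval_sub_xy hlt.le
      have h2 : (y μ - x μ).val = n - (a - b) := by rw [hval_rev hne, h1]
      rw [h1, h2] at hcase
      omega
    obtain ⟨t, ht1, htn, rfl⟩ := mem_stepsFwd hz
    rw [hval_sub_yx hab] at htn
    refine ⟨?_, fun ν hν => by rw [Function.update_of_ne hν]⟩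
    rw [Function.update_self]
    have htlt : t < n := by omega
    have hval : (x μ + (t : ZMod n)).val = a + t := by
      rw [ZMod.val_add_of_lt, ZMod.val_natCast, Nat.mod_eq_of_lt htlt]
      rw [ZMod.val_natCast, Nat.mod_eq_of_lt htlt]; omega
    rw [hval]
    exact div_eq_of_mem (by omega) (by omega)
  · -- backward arc chosen: then `b ≤ a`
    have hba : b ≤ a := by
      by_contra hlt
      push Not at hlt
      have hne : y μ ≠ x μ := fun e => by rw [ha, hb, e] at hlt; exact lt_irrefl _ hlt
      have h1 : (y μ - x μ).val = b - a := hval_sub_yx hlt.le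
      have h2 : (x μ - y μ).val = n - (b - a) := by rw [hval_rev hne, h1]
      rw [h1, h2] at hcase
      omega
    obtain ⟨t, ht1, htn, rfl⟩ := mem_stepsBwd hz
    rw [hval_sub_xy hba] at htn
    refine ⟨?_, fun ν hν => by rw [Function.update_of_ne hν]⟩
    rw [Function.update_self]
    have htlt : t < n := by omega
    have htval : ((t : ℕ) : ZMod n).val = t := by rw [ZMod.val_natCast, Nat.mod_eq_of_lt htlt]
    have hval : (x μ - (t : ZMod n)).val = a - t := by
      rw [ZMod.val_sub (by rw [htval]; omega), htval]
    rw [hval]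
    exact div_eq_of_mem (by omega) (by omega)

/-- **The coordinatewise path between two points of a cube stays in the cube**: for `x, y ∈ □(v)` and any start point `x′` whose
coordinates are each `x`'s or `y`'s, every site of `legs y x′ ms` (p26's path: the listed coordinates walked one after the other)
lies in `□(v)`. [cite: Balaban1982Higgs1, (1.20) p.607] -/
theorem blockIter_eq_of_mem_legs (hk : k ≤ P.K) {x y : HiggsLattice.Site P 0} {v : HiggsLattice.Site P k}
    (hx : blockIter k x = v) (hy : blockIter k y = v) :
    ∀ (x' : HiggsLattice.Site P 0) (ms : List (Fin P.d)), (∀ ν, x' ν = x ν ∨ x' ν = y ν) →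
      ∀ z ∈ legs y x' ms, blockIter k z = v
  | x', [], _, z, hz => by simp [legs] at hz
  | x', μ :: ms, hx', z, hz => by
    rw [legs, List.mem_append] at hz
    have hxv := (blockIter_eq_iff x v).1 hx
    have hyv := (blockIter_eq_iff y v).1 hy
    -- the current start point is in the cube
    have hx'v : ∀ ν, (x' ν).val / P.L ^ k = (v ν).val := fun ν => by
      rcases hx' ν with h | h
      · rw [h]; exact hxv ν
      · rw [h]; exact hyv ν
    rcases hz with hz | hz
    · -- on the leg in direction `μ`
      have hn : 2 * P.L ^ k ≤ P.sitesPerDir 0 μ := by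
        rw [B2Ineq329ZeroAveraging.sitesPerDir_zero_eq hk μ, HiggsLattice.Params.sitesPerDir]
        have h1 : 1 ≤ P.L ^ (P.K - k) * P.M * P.Lp μ :=
          Nat.one_le_iff_ne_zero.mpr (Nat.mul_ne_zero (Nat.mul_ne_zero (pow_ne_zero _ (by have := P.hL; omega))
            (by have := P.hM; omega)) (by have := P.hLp μ; omega))
        calc 2 * P.L ^ k = P.L ^ k * (2 * 1) := by ring
          _ ≤ P.L ^ k * (2 * (P.L ^ (P.K - k) * P.M * P.Lp μ)) := Nat.mul_le_mul_left _ (Nat.mul_le_mul_left _ h1)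
      obtain ⟨hμ, hν⟩ := mem_leg_coords hn (hx'v μ) (hyv μ) hz
      refine (blockIter_eq_iff z v).2 fun ν => ?_
      by_cases h : ν = μ
      · subst h; exact hμ
      · rw [hν ν h]; exact hx'v ν
    · -- on the later legs, from the corner `x′` with its `μ`-th coordinate set to `y_μ`
      refine blockIter_eq_of_mem_legs hk hx hy (Function.update x' μ (y μ)) ms (fun ν => ?_) z hz
      by_cases h : ν = μ
      · subst h; exact Or.inr (Function.update_self _ _ _)
      · rw [Function.update_of_ne h]; exact hx' ν

/-- **The contour `Γ_{x₁,x₂}` used for the transports of (1.32)**: p26's coordinatewise shortest lattice path `legs x₂ x₁ (0, …, d−1)`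
(*"a shortest contour connecting x and x′"*, [B3] p. 420 / [B1] p. 610; admissible in the sense of p26's `IsAdm`).
[cite: Balaban1983Higgs3, (1.32) p.420] -/
def cpath (x₁ x₂ : HiggsLattice.Site P 0) : List (HiggsLattice.Site P 0) := legs x₂ x₁ (List.finRange P.d)

/-- `Γ_{x₁,x₂}` is admissible: a nearest-neighbour chain from `x₁` to `x₂` with `|Γ| ≤ d·|x₁ − x₂|` (p26's `exists_isAdm`, for the
named contour). [cite: Balaban1982Higgs1, Prop. 2.1 p.610] -/
theorem isAdm_cpath (x₁ x₂ : HiggsLattice.Site P 0) : IsAdm x₁ x₂ (cpath x₁ x₂) := by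
  refine ⟨isTChain_legs x₂ x₁ _, ?_, ?_⟩
  · rw [cpath, pathEnd_legs]; funext ν; simp
  · have h := length_legs_le x₁ x₂ x₁ (List.finRange P.d) fun ν => Or.inl rfl
    rw [List.length_finRange] at h
    exact_mod_cast h

/-- `Γ_{x₁,x₂}` ends at `x₂`. [cite: Balaban1982Higgs1, Prop. 2.1 p.610] -/
theorem pathEnd_cpath (x₁ x₂ : HiggsLattice.Site P 0) : pathEnd x₁ (cpath x₁ x₂) = x₂ := (isAdm_cpath x₁ x₂).2.1

/-- `Γ_{x,x}` is the empty contour (every leg has length `0`). [cite: Balaban1982Higgs1, Prop. 2.1 p.610] -/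
theorem cpath_self (x : HiggsLattice.Site P 0) : cpath x x = [] := by
  apply List.eq_nil_of_length_eq_zero
  have h := length_legs_le x x x (List.finRange P.d) fun ν => Or.inl rfl
  rw [tdist_self, mul_zero] at h
  exact Nat.le_zero.mp h

/-- **`Γ_{y₁,y₂}` between two points of a cube stays in the cube.** [cite: Balaban1982Higgs1, (1.20) p.607] -/
theorem blockIter_eq_of_mem_cpath (hk : k ≤ P.K) {y₁ y₂ : HiggsLattice.Site P 0} {v : HiggsLattice.Site P k}
    (h₁ : blockIter k y₁ = v) (h₂ : blockIter k y₂ = v) : ∀ z ∈ y₁ :: cpath y₁ y₂, blockIter k z = v := by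
  intro z hz
  rcases List.mem_cons.mp hz with rfl | hz
  · exact h₁
  · exact blockIter_eq_of_mem_legs hk h₁ h₂ y₁ (List.finRange P.d) (fun ν => Or.inl rfl) z hz

end Geometry

/-! ## §2 The scale sum over the pieces (2.6) at separated arguments -/

section ScaleSum

variable {k : ℕ}

/-- the block number `L − 1` of the scale function `sc` (`B4Thm110ZeroBox.sc ℓ k j = (ℓ+1)^{k−j}`). [folklore] -/
private theorem cast_L_pred (P : HiggsLattice.Params) : (((P.L - 1 : ℕ) : ℝ) + 1) = (P.L : ℝ) := by
  rw [Nat.cast_sub (Nat.one_le_iff_ne_zero.mpr (by have := P.hL; omega)), Nat.cast_one, sub_add_cancel]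

/-- `sc (L−1) k j = L^{k−j}`. [folklore] -/
private theorem sc_eq (P : HiggsLattice.Params) (k j : ℕ) : sc (P.L - 1) k j = (P.L : ℝ) ^ (k - j) := by
  unfold sc; rw [cast_L_pred]

/-- `L^kε = L^{k−j}·L^jε` for `j ≤ k`. [cite: Balaban1982Higgs1, (1.19) p.607] -/
theorem mesh_eq_sc_mul {j : ℕ} (hjk : j ≤ k) : P.mesh k = (P.L : ℝ) ^ (k - j) * P.mesh j := by
  rw [mesh_eq_pow_mul P k, mesh_eq_pow_mul P j, ← mul_assoc, ← pow_add, Nat.sub_add_cancel hjk]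

/-- `|x−x′|/L^j = (|x−x′|/L^k)·L^{k−j}` for `j ≤ k`. [folklore] -/
private theorem div_pow_eq_div_mul_sc {j : ℕ} (hjk : j ≤ k) (t : ℝ) :
    t / (P.L : ℝ) ^ j = t / (P.L : ℝ) ^ k * (P.L : ℝ) ^ (k - j) := by
  have hL : (P.L : ℝ) ≠ 0 := by have := P.hL; positivity
  obtain ⟨m, rfl⟩ := Nat.exists_eq_add_of_le hjk
  rw [Nat.add_sub_cancel_left, pow_add]
  field_simp

/-- **The generic summation over the pieces at separated arguments**: terms bounded by `C·w_j·e^{−δ·|x−x′|/L^j}` with weights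
`w_j ≤ W·(L^{k−j})^p` sum, for `|x−x′|/L^k = D ≥ 1`, to at most `C·W·Φ(p,δ,L)·e^{−(δL/2)D}` (`B3GkZeroBoxSeparated.scaleSum_sep_le`).
[cite: Balaban1983Higgs3, (2.6) p.424] -/
theorem sum_pieces_sep_le (hL2 : 2 ≤ P.L) {p : ℕ} {Cst W δ D : ℝ} (hCst : 0 ≤ Cst) (hW : 0 ≤ W) (hδ : 0 < δ) (hD : 1 ≤ D)
    (T w : ℕ → ℝ) (hT : ∀ j, j < k → T j ≤ Cst * w j * Real.exp (-(δ * (D * (P.L : ℝ) ^ (k - j)))))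
    (hw : ∀ j, j < k → w j ≤ W * ((P.L : ℝ) ^ (k - j)) ^ p) :
    ∑ j ∈ Finset.range k, T j
      ≤ Cst * W * ((p.factorial : ℝ) / (δ * 1 / 2) ^ p * (1 - Real.exp (-(δ * 1 / 2 * (((P.L - 1 : ℕ) : ℝ) + 1))))⁻¹) *
          Real.exp (-(δ * (((P.L - 1 : ℕ) : ℝ) + 1) / 2 * D)) := by
  have hℓ : 1 ≤ P.L - 1 := by omega
  have hsum := scaleSum_sep_le hℓ hδ one_pos p k hD
  simp only [sc_eq] at hsum
  calc ∑ j ∈ Finset.range k, T j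
      ≤ ∑ j ∈ Finset.range k, Cst * W * (((P.L : ℝ) ^ (k - j)) ^ p * Real.exp (-(δ * D * (P.L : ℝ) ^ (k - j)))) := by
        refine Finset.sum_le_sum fun j hj => ?_
        have hj' := Finset.mem_range.1 hj
        refine (hT j hj').trans ?_
        rw [mul_assoc δ D]
        have he : 0 ≤ Real.exp (-(δ * (D * (P.L : ℝ) ^ (k - j)))) := (Real.exp_pos _).le
        calc Cst * w j * Real.exp (-(δ * (D * (P.L : ℝ) ^ (k - j))))
            ≤ Cst * (W * ((P.L : ℝ) ^ (k - j)) ^ p) * Real.exp (-(δ * (D * (P.L : ℝ) ^ (k - j)))) :=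
              mul_le_mul_of_nonneg_right (mul_le_mul_of_nonneg_left (hw j hj') hCst) he
          _ = _ := by ring
    _ = Cst * W * ∑ j ∈ Finset.range k, ((P.L : ℝ) ^ (k - j)) ^ p * Real.exp (-(δ * D * (P.L : ℝ) ^ (k - j))) := by
        rw [Finset.mul_sum]
    _ ≤ _ := by
        rw [mul_assoc (Cst * W)]
        exact mul_le_mul_of_nonneg_left hsum (mul_nonneg hCst hW)

end ScaleSum

/-! ## §3 The full propagator `G_k(T_η, A) = Σ_{j<k} G^η_{(j)}` through the pieces (2.6): its kernel, row derivative, transported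
row difference and twice-differentiated kernel are dominated term by term -/

section Pieces

variable (C : ChargeData N) (A : HiggsLattice.VecField P 0) (msq a : ℝ) {k : ℕ}

/-- value: `‖(G^ε_kφ)(x)‖ ≤ Σ_{j<k}‖(G^η_{(j)}φ)(x)‖` ((2.6)). [cite: Balaban1983Higgs3, (2.6) p.424] -/
theorem norm_G_apply_le_sum (hm : 0 ≤ msq) (ha : 0 < a) (hL1 : 1 < P.L) (hk : 1 ≤ k) (hkK : k ≤ P.K) (φ : ScalarField P 0 N)
    (x : HiggsLattice.Site P 0) :
    ‖propagatorK C Finset.univ A msq a k φ x‖ ≤ ∑ j ∈ Finset.range k, ‖pieceA C A msq a k j φ x‖ := by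
  rw [← sum_pieceA (C := C) (A := A) hm ha hL1 hk hkK, LinearMap.sum_apply, Finset.sum_apply]
  exact norm_sum_le _ _

/-- row derivative: `‖(D^ε_AG^ε_kφ)(b)‖ ≤ Σ_{j<k}‖(D^ε_AG^η_{(j)}φ)(b)‖`. [cite: Balaban1983Higgs3, (2.6) p.424] -/
theorem norm_covDeriv_G_apply_le_sum (hm : 0 ≤ msq) (ha : 0 < a) (hL1 : 1 < P.L) (hk : 1 ≤ k) (hkK : k ≤ P.K)
    (φ : ScalarField P 0 N) (b : HiggsLattice.PBond P 0) :
    ‖covDeriv C A (propagatorK C Finset.univ A msq a k φ) b‖ ≤ ∑ j ∈ Finset.range k, ‖covDeriv C A (pieceA C A msq a k j φ) b‖ := by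
  rw [← sum_pieceA (C := C) (A := A) hm ha hL1 hk hkK, LinearMap.sum_apply, covDeriv_sum'']
  exact norm_sum_le _ _

/-- transported row difference: `‖U(A(Γ))(D^ε_AG^ε_kφ)(⟨x₂,μ⟩) − (D^ε_AG^ε_kφ)(⟨x₁,μ⟩)‖ ≤ Σ_{j<k}‖…G^η_{(j)}…‖`.
[cite: Balaban1983Higgs3, (2.6) p.424] -/
theorem norm_hol_covDeriv_G_sub_le_sum (hm : 0 ≤ msq) (ha : 0 < a) (hL1 : 1 < P.L) (hk : 1 ≤ k) (hkK : k ≤ P.K)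
    (φ : ScalarField P 0 N) (x₁ x₂ : HiggsLattice.Site P 0) (Γ : List (HiggsLattice.Site P 0)) (μ : Fin P.d) :
    ‖hol C A x₁ Γ (covDeriv C A (propagatorK C Finset.univ A msq a k φ) ⟨x₂, μ⟩) - covDeriv C A (propagatorK C Finset.univ A msq a k φ) ⟨x₁, μ⟩‖
      ≤ ∑ j ∈ Finset.range k, ‖hol C A x₁ Γ (covDeriv C A (pieceA C A msq a k j φ) ⟨x₂, μ⟩) - covDeriv C A (pieceA C A msq a k j φ) ⟨x₁, μ⟩‖ := by
  rw [← sum_pieceA (C := C) (A := A) hm ha hL1 hk hkK, LinearMap.sum_apply, covDeriv_sum'', covDeriv_sum'', map_sum,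
    ← Finset.sum_sub_distrib]
  exact norm_sum_le _ _

end Pieces

/-! ## §4 The located inputs in the model's units: (2.10) (r14), (2.11) (p26) for the carriers, read back as kernel bounds -/

section Inputs

variable {S : Shape P} {C : ChargeData N} {A : HiggsLattice.VecField P 0} {msq a : ℝ} {k : ℕ}

/-- kernel: `(L^jη)^{2−d} = (L^jη)²·((L^jη)^d)^{−1}` (real exponent). [folklore] -/
private theorem rpow_two_sub (j : ℕ) : P.mesh j ^ ((2 : ℝ) - (P.d : ℝ)) = P.mesh j ^ 2 * (P.mesh j ^ P.d)⁻¹ := by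
  rw [Real.rpow_sub (P.mesh_pos j), div_eq_mul_inv, Real.rpow_natCast _ P.d, Real.rpow_two]

/-- kernel: `(L^jη)^{1−d} = (L^jη)·((L^jη)^d)^{−1}`. [folklore] -/
private theorem rpow_one_sub (j : ℕ) : P.mesh j ^ ((1 : ℝ) - (P.d : ℝ)) = P.mesh j * (P.mesh j ^ P.d)⁻¹ := by
  rw [Real.rpow_sub (P.mesh_pos j), div_eq_mul_inv, Real.rpow_natCast _ P.d, Real.rpow_one]

/-- kernel: `(L^jη)^{1−d−α} = (L^jη)·((L^jη)^d)^{−1}·((L^jη)^α)^{−1}`. [folklore] -/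
private theorem rpow_one_sub_sub (j : ℕ) (α : ℝ) :
    P.mesh j ^ ((1 : ℝ) - (P.d : ℝ) - α) = P.mesh j * (P.mesh j ^ P.d)⁻¹ * (P.mesh j ^ α)⁻¹ := by
  have hs := P.mesh_pos j
  rw [Real.rpow_sub hs, Real.rpow_sub hs, Real.rpow_one, Real.rpow_natCast _ P.d, div_eq_mul_inv, div_eq_mul_inv]

/-- kernel: `(L^jη)^{−1}·(ε·m) = m/L^j`. [folklore] -/
private theorem scale_inv_mul (j : ℕ) (m : ℝ) : (P.mesh j)⁻¹ * (P.mesh 0 * m) = m / (P.L : ℝ) ^ j := by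
  rw [mesh_eq_pow_mul P j, mul_inv, mul_assoc, ← mul_assoc (P.mesh 0)⁻¹, inv_mul_cancel₀ (P.mesh_pos 0).ne', one_mul,
    div_eq_inv_mul]

/-- **(2.10) for r14's carrier, read back in the model's units**: value and row-derivative kernel bounds of every piece.
[cite: Balaban1983Higgs3, (2.10) p.426] -/
theorem bounds_of_ineq210 {δ₁ Cst : ℝ} (h : (regTorusKernels S C A msq a k).Ineq210 δ₁ Cst) (j : ℕ)
    (x x' : HiggsLattice.Site P 0) :
    (P.mesh 0 ^ P.d)⁻¹ * ∑ i' : Ix N, ‖pieceA C A msq a k j (cb P N 0 (x', i')) x‖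
        ≤ Cst * (P.mesh j ^ 2 * (P.mesh j ^ P.d)⁻¹) * Real.exp (-(δ₁ * ((HiggsLattice.Site.tdist x x' : ℝ) / (P.L : ℝ) ^ j))) ∧
      ∀ μ : Fin P.d, (P.mesh 0 ^ P.d)⁻¹ * ∑ i' : Ix N, ‖covDeriv C A (pieceA C A msq a k j (cb P N 0 (x', i'))) ⟨x, μ⟩‖
        ≤ Cst * (P.mesh j * (P.mesh j ^ P.d)⁻¹) * Real.exp (-(δ₁ * ((HiggsLattice.Site.tdist x x' : ℝ) / (P.L : ℝ) ^ j))) := by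
  have hj := h j x x'
  rw [scale_eq, regTorusKernels_d, regTorusKernels_dist, regTorusKernels_absG, rpow_two_sub, rpow_one_sub, mul_assoc δ₁,
    scale_inv_mul] at hj
  refine ⟨hj.1, fun μ => ?_⟩
  have h2 := hj.2 μ
  rw [regTorusKernels_absDG] at h2
  exact h2

/-- **(2.11) for p26's carrier, read back in the model's units**: every admissible contour's transported Hölder term of every piece is
bounded by `|x₁ − x₂|^α·C·(L^jη)^{1−d−α}·e^{−δ₁(L^jη)^{−1}dist({x₁,x₂},x)}` (`|x₁ − x₂| = ε·tdist`).
[cite: Balaban1983Higgs3, (2.11) p.426] -/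
theorem bound_of_ineq211At {α δ₁ Cst : ℝ} (h : (regTorusKernelsH S C A msq a k).Ineq211At α δ₁ Cst) (j : ℕ) (μ : Fin P.d)
    {x₁ x₂ : HiggsLattice.Site P 0} (hne : x₁ ≠ x₂) (x : HiggsLattice.Site P 0) {Γ : List (HiggsLattice.Site P 0)}
    (hΓ : IsAdm x₁ x₂ Γ) :
    holderTerm C A msq a k j μ x₁ x₂ x Γ
      ≤ (P.mesh 0 * (HiggsLattice.Site.tdist x₁ x₂ : ℝ)) ^ α *
        (Cst * (P.mesh j * (P.mesh j ^ P.d)⁻¹ * (P.mesh j ^ α)⁻¹) *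
          Real.exp (-(δ₁ * (min (HiggsLattice.Site.tdist x₁ x : ℝ) (HiggsLattice.Site.tdist x₂ x : ℝ) / (P.L : ℝ) ^ j)))) := by
  have hj := h j μ x₁ x₂ x hne
  have hsc : (regTorusKernelsH S C A msq a k).scale j = P.mesh j := B3Ineq211RegularTorus.scaleH_eq j
  have hd : ((regTorusKernelsH S C A msq a k).d : ℝ) = (P.d : ℝ) := rfl
  have hdist : (regTorusKernelsH S C A msq a k).dist x₁ x₂ = P.mesh 0 * (HiggsLattice.Site.tdist x₁ x₂ : ℝ) := rfl
  have hdist2 : (regTorusKernelsH S C A msq a k).dist2 x₁ x₂ x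
      = P.mesh 0 * min (HiggsLattice.Site.tdist x₁ x : ℝ) (HiggsLattice.Site.tdist x₂ x : ℝ) := rfl
  rw [hsc, hd, hdist, hdist2, rpow_one_sub_sub, mul_assoc δ₁, scale_inv_mul] at hj
  have ht : 0 < P.mesh 0 * (HiggsLattice.Site.tdist x₁ x₂ : ℝ) := by
    refine mul_pos (P.mesh_pos 0) ?_
    exact_mod_cast B3Ineq211RegularTorus.one_le_tdist_of_ne' (Ne.symm hne)
  have hpow : 0 < (P.mesh 0 * (HiggsLattice.Site.tdist x₁ x₂ : ℝ)) ^ α := Real.rpow_pos_of_pos ht _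
  rw [div_le_iff₀ hpow] at hj
  calc holderTerm C A msq a k j μ x₁ x₂ x Γ ≤ (regTorusKernelsH S C A msq a k).holderDiff j μ x₁ x₂ x :=
        holderTerm_le_holderDiff j μ x₁ x₂ x hΓ
    _ ≤ _ := by rw [mul_comm]; exact hj

end Inputs

/-! ## §5 The blocks of the kernel of `G_k(T_η, A)` as maps of `ℝ^N`, the row-differentiated blocks, and their norms -/

section Blocks

variable (C : ChargeData N) (A : HiggsLattice.VecField P 0) (msq a : ℝ) (k : ℕ)

/-- The `N × N` block `G^ε_k(T_ε, A; x, x′) : v ↦ (G^ε_kδ_{x′}v)(x)` of the kernel, as a map of `ℝ^N` (the typer's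
`HiggsCovariance.kernel`, made continuous). [cite: Balaban1982Higgs1, (2.24) p.610] [cite: Balaban1983Higgs3, (3.1) p.432] -/
def blockK (x x' : HiggsLattice.Site P 0) : E N →L[ℝ] E N :=
  LinearMap.toContinuousLinearMap (HiggsCovariance.kernel (propagatorK C Finset.univ A msq a k) x x')

/-- The ROW-DIFFERENTIATED block `v ↦ (D^ε_{A}G^ε_kδ_{x′}v)(b)` = `ε^{−1}(U(A_b)G^ε_k(b₊,x′) − G^ε_k(b₋,x′))`.
[cite: Balaban1982Higgs1, (1.7) p.605] [cite: Balaban1983Higgs3, (1.32) p.420] -/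
def blockDK (b : HiggsLattice.PBond P 0) (x' : HiggsLattice.Site P 0) : E N →L[ℝ] E N :=
  (P.mesh 0)⁻¹ • ((C.U (P.mesh 0) (A b)).comp (blockK C A msq a k b.tgt x') - blockK C A msq a k b.src x')

variable {C A msq a k}

/-- `G^ε_k(x,x′)v = (G^ε_kδ_{x′}v)(x)`. [cite: Balaban1982Higgs1, (2.24) p.610] -/
theorem blockK_apply (x x' : HiggsLattice.Site P 0) (v : E N) :
    blockK C A msq a k x x' v = propagatorK C Finset.univ A msq a k (Pi.single x' v) x := by
  simp [blockK, HiggsCovariance.kernel]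

/-- `(D G^ε_k)(b,x′)v = (D^ε_AG^ε_kδ_{x′}v)(b)`. [cite: Balaban1982Higgs1, (1.7) p.605] -/
theorem blockDK_apply (b : HiggsLattice.PBond P 0) (x' : HiggsLattice.Site P 0) (v : E N) :
    blockDK C A msq a k b x' v = covDeriv C A (propagatorK C Finset.univ A msq a k (Pi.single x' v)) b := by
  simp only [blockDK, _root_.smul_apply, _root_.sub_apply, ContinuousLinearMap.comp_apply, blockK_apply]
  rfl

/-- `‖G^ε_k(x,x′)‖ ≤ Σ_{i′}‖(G^ε_ke_{(x′,i′)})(x)‖` (operator norm below the column sum). [cite: Balaban1983Higgs3, (3.1) p.432] -/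
theorem norm_blockK_le (x x' : HiggsLattice.Site P 0) :
    ‖blockK C A msq a k x x'‖ ≤ ∑ i' : Ix N, ‖propagatorK C Finset.univ A msq a k (cb P N 0 (x', i')) x‖ := by
  refine ContinuousLinearMap.opNorm_le_bound _ (Finset.sum_nonneg fun _ _ => norm_nonneg _) fun v => ?_
  rw [blockK_apply, mul_comm]
  exact norm_apply_single_le _ x' v x

/-- `‖(DG^ε_k)(b,x′)‖ ≤ Σ_{i′}‖(D^ε_AG^ε_ke_{(x′,i′)})(b)‖`. [cite: Balaban1983Higgs3, (3.1) p.432] -/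
theorem norm_blockDK_le (b : HiggsLattice.PBond P 0) (x' : HiggsLattice.Site P 0) :
    ‖blockDK C A msq a k b x'‖ ≤ ∑ i' : Ix N, ‖covDeriv C A (propagatorK C Finset.univ A msq a k (cb P N 0 (x', i'))) b‖ := by
  refine ContinuousLinearMap.opNorm_le_bound _ (Finset.sum_nonneg fun _ _ => norm_nonneg _) fun v => ?_
  rw [blockDK_apply, mul_comm]
  exact norm_covDeriv_apply_single_le C A _ x' v b

/-- `‖U(A(Γ))‖ ≤ 1` (an isometry). [cite: Balaban1982Higgs1, (1.7) p.605] -/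
theorem norm_hol_le_one (x : HiggsLattice.Site P 0) (Γ : List (HiggsLattice.Site P 0)) : ‖hol C A x Γ‖ ≤ 1 :=
  ContinuousLinearMap.opNorm_le_bound _ zero_le_one fun v => by rw [norm_hol_apply, one_mul]

/-- Composition with a transport does not increase the norm. [cite: Balaban1982Higgs1, (1.7) p.605] -/
theorem norm_hol_comp_le (x : HiggsLattice.Site P 0) (Γ : List (HiggsLattice.Site P 0)) (M : E N →L[ℝ] E N) :
    ‖(hol C A x Γ).comp M‖ ≤ ‖M‖ :=
  (ContinuousLinearMap.opNorm_comp_le _ _).trans (by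
    have := norm_hol_le_one (C := C) (A := A) x Γ
    have h0 := norm_nonneg M
    nlinarith)

/-- **The row move**: `‖U(A(Γ))(DG^ε_k)(⟨x₂,μ⟩,y) − (DG^ε_k)(⟨x₁,μ⟩,y)‖ ≤ Σ_{i′}‖U(A(Γ))(D^ε_AG^ε_ke_{(y,i′)})(⟨x₂,μ⟩) − (D^ε_AG^ε_ke_{(y,i′)})(⟨x₁,μ⟩)‖`.
[cite: Balaban1983Higgs3, (1.32) p.420] -/
theorem norm_hol_comp_blockDK_sub_le (x₁ x₂ y : HiggsLattice.Site P 0) (Γ : List (HiggsLattice.Site P 0)) (μ : Fin P.d) :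
    ‖(hol C A x₁ Γ).comp (blockDK C A msq a k ⟨x₂, μ⟩ y) - blockDK C A msq a k ⟨x₁, μ⟩ y‖
      ≤ ∑ i' : Ix N, ‖hol C A x₁ Γ (covDeriv C A (propagatorK C Finset.univ A msq a k (cb P N 0 (y, i'))) ⟨x₂, μ⟩)
          - covDeriv C A (propagatorK C Finset.univ A msq a k (cb P N 0 (y, i'))) ⟨x₁, μ⟩‖ := by
  refine ContinuousLinearMap.opNorm_le_bound _ (Finset.sum_nonneg fun _ _ => norm_nonneg _) fun v => ?_
  rw [_root_.sub_apply, ContinuousLinearMap.comp_apply, blockDK_apply, blockDK_apply, mul_comm]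
  refine (B3Ineq211RegularTorus.norm_hol_covDeriv_sub_le_sum_coord C A _ _ x₁ x₂ Γ μ).trans ?_
  rw [Fintype.sum_prod_type, Finset.sum_eq_single y, Finset.mul_sum]
  · exact Finset.sum_le_sum fun i' _ => mul_le_mul_of_nonneg_right (abs_fieldCoord_single_le y v _) (norm_nonneg _)
  · intro x _ hx
    exact Finset.sum_eq_zero fun i' _ => by rw [fieldCoord_single_of_ne y v (s := (x, i')) hx, abs_zero, zero_mul]
  · intro h; exact absurd (Finset.mem_univ y) h

/-- An operator norm from its bilinear form: `|⟨w, Xv⟩| ≤ B‖v‖‖w‖` for all `v, w` gives `‖X‖ ≤ B`. [folklore] -/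
private theorem opNorm_le_of_inner_le (X : E N →L[ℝ] E N) {B : ℝ} (hB : 0 ≤ B) (h : ∀ v w : E N, |⟪w, X v⟫_ℝ| ≤ B * ‖v‖ * ‖w‖) :
    ‖X‖ ≤ B := by
  refine ContinuousLinearMap.opNorm_le_bound _ hB fun v => ?_
  have h1 := h v (X v)
  rw [real_inner_self_eq_norm_sq, abs_of_nonneg (sq_nonneg _)] at h1
  by_cases h0 : ‖X v‖ = 0
  · rw [h0]; positivity
  · have hpos : 0 < ‖X v‖ := lt_of_le_of_ne (norm_nonneg _) (Ne.symm h0)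
    nlinarith

/-- **The column move** (the path lemma on the column field `ε^{−1}G^ε_k(dip_b w)`): for a chain `Γ′` from `y₁` to `y₂` inside a set
`Ω` on whose bonds `‖(D^ε_AG^ε_k dip_b w)(c)‖ ≤ M_×‖w‖`, `‖(DG^ε_k)(b,y₂)∘U(A(Γ′))^* − (DG^ε_k)(b,y₁)‖ ≤ |Γ′|·M_×` — the adjoint identity
`⟨w,(DG^ε_kδ_yv)(b)⟩ = ε^{−1}⟨(G^ε_k dip_b w)(y), v⟩` turns the difference into `ε^{−1}⟨U(A(Γ′))ψ(y₂) − ψ(y₁), v⟩`, `ψ = G^ε_k dip_b w`.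
[cite: Balaban1983Higgs3, (1.32) p.420] [cite: Balaban1983RegularityDecay, p.578] -/
theorem norm_blockDK_comp_star_sub_le (hS : ∀ μ, 2 < P.sitesPerDir 0 μ) (b : HiggsLattice.PBond P 0)
    (Ω : Finset (HiggsLattice.Site P 0)) {Mx : ℝ} (hMx : 0 ≤ Mx)
    (hD : ∀ (c : HiggsLattice.PBond P 0) (w : E N), c.src ∈ Ω → c.tgt ∈ Ω →
      ‖covDeriv C A (propagatorK C Finset.univ A msq a k (dip C A b w)) c‖ ≤ Mx * ‖w‖)
    {y₁ : HiggsLattice.Site P 0} {Γ' : List (HiggsLattice.Site P 0)} (hch : IsTChain y₁ Γ') (hΩ : ∀ z ∈ y₁ :: Γ', z ∈ Ω) :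
    ‖(blockDK C A msq a k b (pathEnd y₁ Γ')).comp (star (hol C A y₁ Γ')) - blockDK C A msq a k b y₁‖ ≤ (Γ'.length : ℝ) * Mx := by
  have hε : 0 < P.mesh 0 := P.mesh_pos 0
  refine opNorm_le_of_inner_le _ (by positivity) fun v w => ?_
  set ψ : ScalarField P 0 N := propagatorK C Finset.univ A msq a k (dip C A b w) with hψ
  -- the bilinear form through the column field `ψ`
  have hform : ⟪w, ((blockDK C A msq a k b (pathEnd y₁ Γ')).comp (star (hol C A y₁ Γ')) - blockDK C A msq a k b y₁) v⟫_ℝ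
      = (P.mesh 0)⁻¹ * ⟪hol C A y₁ Γ' (ψ (pathEnd y₁ Γ')) - ψ y₁, v⟫_ℝ := by
    rw [_root_.sub_apply, ContinuousLinearMap.comp_apply, inner_sub_right, blockDK_apply, blockDK_apply,
      inner_covDeriv_propagatorK_single, inner_covDeriv_propagatorK_single, ContinuousLinearMap.star_eq_adjoint,
      ContinuousLinearMap.adjoint_inner_right, inner_sub_left, mul_sub]
  rw [hform, abs_mul, abs_of_nonneg (inv_nonneg.mpr hε.le)]
  -- the path lemma on `ψ` inside `Ω`
  have hpath := norm_hol_apply_sub_le hS C A ψ Ω (G := Mx * ‖w‖)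
    (fun y μ hy hyμ => hD ⟨y, μ⟩ w hy hyμ) hch hΩ
  have hin : |⟪hol C A y₁ Γ' (ψ (pathEnd y₁ Γ')) - ψ y₁, v⟫_ℝ| ≤ P.mesh 0 * Γ'.length * (Mx * ‖w‖) * ‖v‖ :=
    (abs_real_inner_le_norm _ _).trans (mul_le_mul_of_nonneg_right hpath (norm_nonneg _))
  calc (P.mesh 0)⁻¹ * |⟪hol C A y₁ Γ' (ψ (pathEnd y₁ Γ')) - ψ y₁, v⟫_ℝ|
      ≤ (P.mesh 0)⁻¹ * (P.mesh 0 * Γ'.length * (Mx * ‖w‖) * ‖v‖) := mul_le_mul_of_nonneg_left hin (inv_nonneg.mpr hε.le)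
    _ = (Γ'.length : ℝ) * Mx * ‖v‖ * ‖w‖ * ((P.mesh 0)⁻¹ * P.mesh 0) := by ring
    _ = (Γ'.length : ℝ) * Mx * ‖v‖ * ‖w‖ := by rw [inv_mul_cancel₀ hε.ne', mul_one]

end Blocks

/-! ## §6 The two-variable field `(x,x′) ↦ G_k(T_η,A;x,x′)` on `□(v) × □(v′)`, its covariant derivatives in the `2d` directions of the
product lattice, the transports, and the norm (1.32) "extended in a natural way to functions of many variables" -/

section Field

/-- Sites of the product lattice `T_η × T_η`. [cite: Balaban1983Higgs3, (1.32) p.420] -/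
abbrev PSite (P : HiggsLattice.Params) : Type := HiggsLattice.Site P 0 × HiggsLattice.Site P 0

/-- Bonds of the product lattice, indexed as `(direction, base point)`: a ROW bond `inl (μ, (x,x′))` from `(x,x′)` to `(x+εe_μ, x′)`,
a COLUMN bond `inr (ν, (x,x′))` from `(x,x′)` to `(x, x′+εe_ν)` (p03's indexing in `B3Ineq31ZeroTorus`). [cite: Balaban1983Higgs3, (1.32) p.420] -/
abbrev PBd (P : HiggsLattice.Params) : Type := (Fin P.d × PSite P) ⊕ (Fin P.d × PSite P)

/-- A product bond as (the `T_ε`-bond in the differentiated variable, the site in the other variable): `inl (μ,(x,x′)) ↦ (⟨x,μ⟩, x′)`,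
`inr (ν,(x,x′)) ↦ (⟨x′,ν⟩, x)`. [cite: Balaban1983Higgs3, (1.32) p.420] -/
def hb : PBd P → HiggsLattice.PBond P 0 × HiggsLattice.Site P 0 :=
  Sum.elim (fun c => (⟨c.2.1, c.1⟩, c.2.2)) (fun c => (⟨c.2.2, c.1⟩, c.2.1))

/-- The direction of a product bond (one of the `2d` directions). [cite: Balaban1983Higgs3, (1.32) p.420] -/
def dirOf : PBd P → Fin P.d ⊕ Fin P.d := Sum.elim (fun c => Sum.inl c.1) (fun c => Sum.inr c.1)

/-- The base point `(x, x′)` of a product bond. [cite: Balaban1983Higgs3, (1.32) p.420] -/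
def baseOf : PBd P → PSite P := Sum.elim (fun c => c.2) (fun c => c.2)

/-- The sup-distance of two points of the product lattice in the print's `η`-units for the step `k` (`η = L^{−k}`, one fine lattice step):
`max(|x − y|, |x′ − y′|)/L^k`. [cite: Balaban1983Higgs3, (1.32) p.420] -/
def pdist (k : ℕ) (z z' : PSite P) : ℝ :=
  max (HiggsLattice.Site.tdist z.1 z'.1 : ℝ) (HiggsLattice.Site.tdist z.2 z'.2 : ℝ) / (P.L : ℝ) ^ k

/-- The unit factor of the KERNEL in the print's units for the step `k`: `G_k(T_η,A;x,x′) = (L^kε)^{d−2}·ε^{−d}·(raw block)` (a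
covariance has scaling dimension `2 − d`; `(L^kε)^{d−2}` written `(L^kε)^d·((L^kε)²)^{−1}`). [cite: Balaban1982Higgs1, (2.22) p.610] -/
def unitV (P : HiggsLattice.Params) (k : ℕ) : ℝ := P.mesh k ^ P.d * (P.mesh k ^ 2)⁻¹ * (P.mesh 0 ^ P.d)⁻¹

/-- The unit factor of the DERIVATIVE of the kernel: one `η`-derivative `D^η = (L^kε)·D^ε` more, `(L^kε)^{d−1}·ε^{−d}`.
[cite: Balaban1982Higgs1, (2.22) p.610] -/
def unitD (P : HiggsLattice.Params) (k : ℕ) : ℝ := P.mesh k ^ P.d * (P.mesh k)⁻¹ * (P.mesh 0 ^ P.d)⁻¹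

/-- `unitV > 0`. [folklore] -/
private theorem unitV_pos (P : HiggsLattice.Params) (k : ℕ) : 0 < unitV P k := by
  unfold unitV; have := P.mesh_pos k; have := P.mesh_pos 0; positivity

/-- `unitD > 0`. [folklore] -/
private theorem unitD_pos (P : HiggsLattice.Params) (k : ℕ) : 0 < unitD P k := by
  unfold unitD; have := P.mesh_pos k; have := P.mesh_pos 0; positivity

variable (C : ChargeData N) (A : HiggsLattice.VecField P 0) (msq a : ℝ) (k : ℕ)

/-- **The two-variable field of (3.1)** in the print's units for the step `k`: `F(x,x′) = G_k(T_η,A;x,x′) ∈ Hom(ℝ^N_{x′}, ℝ^N_x)`.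
[cite: Balaban1983Higgs3, (3.1) p.432] -/
def kerF (z : PSite P) : E N →L[ℝ] E N := unitV P k • blockK C A msq a k z.1 z.2

/-- **The covariant derivatives of `F` along the product bonds**: on a row bond `D^η_{A,μ}` in `x` of `x ↦ F(x,x′)`; on a column bond
`D^η_{A,ν}` in `x′` of the column slice `x′ ↦ F(x,x′)^* = G_k(x′,x)` (the symmetry `G^ε_k(x,x′)^* = G^ε_k(x′,x)`,
`B3Ineq210MixedRegularTorus.inner_propagatorK_single_comm`) — both are the row-differentiated block of `hb`.
[cite: Balaban1983Higgs3, (1.32) p.420] -/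
def derivF (c : PBd P) : E N →L[ℝ] E N := unitD P k • blockDK C A msq a k (hb c).1 (hb c).2

/-- **The transport of (1.32) for the two-variable field**: the value at the product bond `c′` is carried to `c` by `U(A(Γ))` on the
fibre of the differentiated variable (from the base of `c′`'s bond to the base of `c`'s bond) and by `U(A(Γ′))^*` on the fibre of the
other variable (between the two sites), `Γ, Γ′` the coordinatewise shortest contours `cpath`: `M ↦ U(A(Γ))∘M∘U(A(Γ′))^*`.
[cite: Balaban1983Higgs3, (1.32) p.420] -/
def transp (c c' : PBd P) (M : E N →L[ℝ] E N) : E N →L[ℝ] E N :=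
  (hol C A (hb c).1.src (cpath (hb c).1.src (hb c').1.src)).comp (M.comp (star (hol C A (hb c).2 (cpath (hb c).2 (hb c').2))))

/-- The localization domain `□(v) × □(v′)` (unit cubes of `T_1^{(k)}`, `⌊x/L^k⌋ = v`). [cite: Balaban1983Higgs3, (3.1) p.432] -/
def sites (v v' : HiggsLattice.Site P k) : Finset (PSite P) :=
  Finset.univ.filter fun z => blockIter k z.1 = v ∧ blockIter k z.2 = v'

/-- The product bonds with BOTH ends in `□(v) × □(v′)`. [cite: Balaban1983Higgs3, (1.32) p.420] -/
def bonds (v v' : HiggsLattice.Site P k) : Finset (PBd P) :=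
  (Finset.univ.filter fun c : Fin P.d × PSite P => c.2 ∈ sites k v v' ∧ blockIter k (c.2.1.shift c.1) = v).disjSum
    (Finset.univ.filter fun c : Fin P.d × PSite P => c.2 ∈ sites k v v' ∧ blockIter k (c.2.2.shift c.1) = v')

/-- **`‖hG_k(T_η,A)h′‖_{1,α}` for the regular-background torus instance**: the printed (1.32) SUM form `B3Sect1Statements.norm132` —
`sup‖F‖ + sup‖DF‖ + sup ‖τ(DF(c′)) − DF(c)‖/|z(c) − z(c′)|^α` over same-direction product-bond pairs — of the two-variable field
`F = G_k(T_η,A;·,·)` on `□(v) × □(v′)`, covariant derivatives in all `2d` directions, transports `U(A(Γ))∘·∘U(A(Γ′))^*`; values in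
`Hom(ℝ^N, ℝ^N)` with the operator norm.  This is the reading of «This definition extends in a natural way to functions of many
variables» (p. 420) used here (p03's reading for `B3Ineq31ZeroTorus`, with the transports of (1.32) restored). [cite: Balaban1983Higgs3, (3.1) p.432] -/
def normHGH (α : ℝ) (v v' : HiggsLattice.Site P k) : ℝ :=
  norm132 α (fun c c' => dirOf c = dirOf c') (fun c c' => pdist k (baseOf c) (baseOf c')) (transp C A)
    (sites k v v') (bonds k v v') (kerF C A msq a k) (derivF C A msq a k)

/-- **The concrete carrier of B3 §3 for `Ω = T_η` at a REGULAR NON-CONSTANT background `B̃ = A`** at the scale `k` of the volume `P`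
of the (Higgs)₂,₃ torus family (`S : Shape P`): localization functions `LocFn` = the unit cubes `□(v)` of p. 420 (labelled by
`v ∈ T_1^{(k)}`), `distCubes = dist(□(v),□(v′))` (`cubeDist`), `normHGH α h h′ = ‖hG_k(T_η,A)h′‖_{1,α}`; the data of (3.2)–(3.5) are NOT
modelled (`RenClass′ = ∅`, so `Ineq32`, `Ineq33`, `Claim35` are vacuous for this carrier and nothing is claimed about them),
`e(L^kε) = λ(L^kε) = 0`. [cite: Balaban1983Higgs3, (3.1) p.432] -/
def sect3RegTorus (_S : Shape P) (C : ChargeData N) (A : HiggsLattice.VecField P 0) (msq a : ℝ) (k : ℕ) : Sect3Data where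
  eRun := 0
  lamRun := 0
  LocFn := HiggsLattice.Site P k
  distCubes := cubeDist k
  normHGH := fun α v v' => normHGH C A msq a k α v v'
  RenClass' := PEmpty
  Loc := fun G => G.elim
  ExtS := PUnit
  ExtV := PUnit
  E' := fun G => G.elim
  E3 := fun G => G.elim
  dv := fun G => G.elim
  ds := fun G => G.elim
  normS := fun _ _ => 0
  normV := fun _ _ => 0
  lhs35 := fun G => G.elim
  GenFamily := fun G => G.elim
  rhs35 := fun G => G.elim
  PosAlongOrderings := fun G => G.elim

variable {C A msq a k}

/-- `(3.1)` for the carrier unfolds to the bound on `normHGH`. [cite: Balaban1983Higgs3, (3.1) p.432] -/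
theorem ineq31_iff (S : Shape P) (α δ₀ Cst : ℝ) :
    (sect3RegTorus S C A msq a k).Ineq31 α δ₀ Cst ↔
      ∀ v v' : HiggsLattice.Site P k, 1 ≤ cubeDist k v v' →
        normHGH C A msq a k α v v' ≤ Cst * Real.exp (-(δ₀ * cubeDist k v v')) :=
  Iff.rfl

/-- Membership in the localization domain. [cite: Balaban1983Higgs3, (3.1) p.432] -/
theorem mem_sites {v v' : HiggsLattice.Site P k} {z : PSite P} :
    z ∈ sites k v v' ↔ blockIter k z.1 = v ∧ blockIter k z.2 = v' := by
  simp [sites]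

/-- The cube of the differentiated variable of a product bond of `□(v) × □(v′)`: `□(v)` for row bonds, `□(v′)` for column bonds.
[cite: Balaban1983Higgs3, (1.32) p.420] -/
def cubeB (v v' : HiggsLattice.Site P k) : PBd P → HiggsLattice.Site P k := Sum.elim (fun _ => v) (fun _ => v')

/-- The cube of the other variable: `□(v′)` for row bonds, `□(v)` for column bonds. [cite: Balaban1983Higgs3, (1.32) p.420] -/
def cubeY (v v' : HiggsLattice.Site P k) : PBd P → HiggsLattice.Site P k := Sum.elim (fun _ => v') (fun _ => v)

/-- The two cubes of a product bond are `□(v), □(v′)` in some order: same distance. [cite: Balaban1983Higgs3, (3.1) p.432] -/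
theorem cubeDist_cubeB_cubeY (v v' : HiggsLattice.Site P k) (c : PBd P) :
    cubeDist k (cubeB v v' c) (cubeY v v' c) = cubeDist k v v' := by
  rcases c with c | c
  · rfl
  · exact cubeDist_comm _ _

/-- What a product bond of the domain knows about its `T_ε`-bond and its other site: the bond's two ends lie in its cube, the site in
the other cube, the base point in `□(v) × □(v′)`. [cite: Balaban1983Higgs3, (1.32) p.420] -/
theorem bonds_spec {v v' : HiggsLattice.Site P k} {c : PBd P} (hc : c ∈ bonds k v v') :
    blockIter k (hb c).1.src = cubeB v v' c ∧ blockIter k (hb c).1.tgt = cubeB v v' c ∧ blockIter k (hb c).2 = cubeY v v' c ∧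
      blockIter k (baseOf c).1 = v ∧ blockIter k (baseOf c).2 = v' := by
  rw [bonds, Finset.mem_disjSum] at hc
  rcases hc with ⟨c, hc, rfl⟩ | ⟨c, hc, rfl⟩
  · simp only [Finset.mem_filter, Finset.mem_univ, true_and, mem_sites] at hc
    exact ⟨hc.1.1, hc.2, hc.1.2, hc.1.1, hc.1.2⟩
  · simp only [Finset.mem_filter, Finset.mem_univ, true_and, mem_sites] at hc
    exact ⟨hc.1.2, hc.2, hc.1.1, hc.1.1, hc.1.2⟩

/-- Same-direction product bonds: same row/column type (hence the same cubes), `T_ε`-bonds of the same direction, and the distance of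
their base points is `max(|bond bases|, |other sites|)/L^k`. [cite: Balaban1983Higgs3, (1.32) p.420] -/
theorem sameDir_spec (v v' : HiggsLattice.Site P k) {c c' : PBd P} (h : dirOf c = dirOf c') :
    (hb c').1 = ⟨(hb c').1.src, (hb c).1.dir⟩ ∧ cubeB v v' c' = cubeB v v' c ∧ cubeY v v' c' = cubeY v v' c ∧
      pdist k (baseOf c) (baseOf c')
        = max (HiggsLattice.Site.tdist (hb c).1.src (hb c').1.src : ℝ) (HiggsLattice.Site.tdist (hb c).2 (hb c').2 : ℝ)
            / (P.L : ℝ) ^ k := by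
  rcases c with ⟨μ, z⟩ | ⟨μ, z⟩ <;> rcases c' with ⟨μ', z'⟩ | ⟨μ', z'⟩ <;>
    simp only [dirOf, Sum.elim_inl, Sum.elim_inr, Sum.inl.injEq, Sum.inr.injEq, reduceCtorEq] at h
  · subst h; exact ⟨rfl, rfl, rfl, rfl⟩
  · subst h; refine ⟨rfl, rfl, rfl, ?_⟩; simp only [pdist, baseOf, hb, Sum.elim_inr]; rw [max_comm]

end Field

/-! ## §7 The three parts of `‖hG_k(T_η,A)h′‖_{1,α}`: the sup of the kernel, the sup of its derivatives, the Hölder quotients -/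

section Parts

variable {k : ℕ}

/-- **The scale-sum constant** `Φ_p(δ, L) = p!/(δ/2)^p · (1 − e^{−(δ/2)L})^{−1}` of `sum_pieces_sep_le` (written with `(L−1)+1`).
[cite: Balaban1983Higgs3, (2.6) p.424] -/
def phiSum (L p : ℕ) (δ : ℝ) : ℝ :=
  (p.factorial : ℝ) / (δ * 1 / 2) ^ p * (1 - Real.exp (-(δ * 1 / 2 * (((L - 1 : ℕ) : ℝ) + 1))))⁻¹

/-- `Φ_p(δ, L) > 0` for `δ > 0`, `L ≥ 1`. [folklore] -/
private theorem phiSum_pos {L : ℕ} (p : ℕ) {δ : ℝ} (hδ : 0 < δ) : 0 < phiSum L p δ := by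
  unfold phiSum
  have h1 : 0 < (p.factorial : ℝ) / (δ * 1 / 2) ^ p := by positivity
  have h2 : 0 < 1 - Real.exp (-(δ * 1 / 2 * (((L - 1 : ℕ) : ℝ) + 1))) := by
    rw [sub_pos, Real.exp_lt_one_iff]
    have : (0 : ℝ) < ((L - 1 : ℕ) : ℝ) + 1 := by positivity
    nlinarith
  exact mul_pos h1 (inv_pos.mpr h2)

/-- `sum_pieces_sep_le` with the constant named and the rate `δL/2` against a SMALLER separation parameter `D₀ ≤ D`
(the cube distance). [cite: Balaban1983Higgs3, (2.6) p.424] -/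
theorem sum_pieces_sep_le' (hL2 : 2 ≤ P.L) {p : ℕ} {Cst W δ D D₀ : ℝ} (hCst : 0 ≤ Cst) (hW : 0 ≤ W) (hδ : 0 < δ) (hD : 1 ≤ D)
    (hD₀ : D₀ ≤ D) (T w : ℕ → ℝ) (hT : ∀ j, j < k → T j ≤ Cst * w j * Real.exp (-(δ * (D * (P.L : ℝ) ^ (k - j)))))
    (hw : ∀ j, j < k → w j ≤ W * ((P.L : ℝ) ^ (k - j)) ^ p) :
    ∑ j ∈ Finset.range k, T j ≤ Cst * W * phiSum P.L p δ * Real.exp (-(δ * P.L / 2 * D₀)) := by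
  calc ∑ j ∈ Finset.range k, T j ≤ Cst * W * phiSum P.L p δ * Real.exp (-(δ * (((P.L - 1 : ℕ) : ℝ) + 1) / 2 * D)) :=
        sum_pieces_sep_le hL2 hCst hW hδ hD T w hT hw
    _ ≤ _ := by
        rw [cast_L_pred]
        refine mul_le_mul_of_nonneg_left ?_ (mul_nonneg (mul_nonneg hCst hW) (phiSum_pos p hδ).le)
        rw [Real.exp_le_exp]
        have hL : (0 : ℝ) < P.L := by exact_mod_cast (by have := P.hL; omega : 0 < P.L)
        have : δ * (P.L : ℝ) / 2 * D₀ ≤ δ * (P.L : ℝ) / 2 * D := mul_le_mul_of_nonneg_left hD₀ (by positivity)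
        linarith

/-- weight of the KERNEL part: `(L^kε)^d((L^kε)²)^{−1}·(L^jε)²((L^jε)^d)^{−1} = (L^{k−j})^{d−2} ≤ (L^{k−j})^{d+1}`.
[cite: Balaban1983Higgs3, (2.10) p.426] -/
theorem weightV_le {j : ℕ} (hjk : j ≤ k) :
    P.mesh k ^ P.d * (P.mesh k ^ 2)⁻¹ * (P.mesh j ^ 2 * (P.mesh j ^ P.d)⁻¹) ≤ 1 * ((P.L : ℝ) ^ (k - j)) ^ (P.d + 1) := by
  have hm : 0 < P.mesh j := P.mesh_pos j
  have hL1 : (1 : ℝ) ≤ P.L := by exact_mod_cast P.hL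
  have hr : 1 ≤ (P.L : ℝ) ^ (k - j) := one_le_pow₀ hL1
  have hr0 : 0 < (P.L : ℝ) ^ (k - j) := by positivity
  rw [mesh_eq_sc_mul hjk, one_mul]
  have e : ((P.L : ℝ) ^ (k - j) * P.mesh j) ^ P.d * (((P.L : ℝ) ^ (k - j) * P.mesh j) ^ 2)⁻¹ * (P.mesh j ^ 2 * (P.mesh j ^ P.d)⁻¹)
      = ((P.L : ℝ) ^ (k - j)) ^ P.d / ((P.L : ℝ) ^ (k - j)) ^ 2 := by
    rw [mul_pow, mul_pow]
    field_simp
  rw [e]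
  calc ((P.L : ℝ) ^ (k - j)) ^ P.d / ((P.L : ℝ) ^ (k - j)) ^ 2 ≤ ((P.L : ℝ) ^ (k - j)) ^ P.d :=
        div_le_self (by positivity) (one_le_pow₀ hr)
    _ ≤ ((P.L : ℝ) ^ (k - j)) ^ (P.d + 1) := pow_le_pow_right₀ hr (Nat.le_succ _)

/-- weight of the DERIVATIVE part: `(L^kε)^d(L^kε)^{−1}·(L^jε)((L^jε)^d)^{−1} = (L^{k−j})^{d−1} ≤ (L^{k−j})^{d+1}`.
[cite: Balaban1983Higgs3, (2.10) p.426] -/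
theorem weightD_le {j : ℕ} (hjk : j ≤ k) :
    P.mesh k ^ P.d * (P.mesh k)⁻¹ * (P.mesh j * (P.mesh j ^ P.d)⁻¹) ≤ 1 * ((P.L : ℝ) ^ (k - j)) ^ (P.d + 1) := by
  have hm : 0 < P.mesh j := P.mesh_pos j
  have hL1 : (1 : ℝ) ≤ P.L := by exact_mod_cast P.hL
  have hr : 1 ≤ (P.L : ℝ) ^ (k - j) := one_le_pow₀ hL1
  have hr0 : 0 < (P.L : ℝ) ^ (k - j) := by positivity
  rw [mesh_eq_sc_mul hjk, one_mul]
  have e : ((P.L : ℝ) ^ (k - j) * P.mesh j) ^ P.d * ((P.L : ℝ) ^ (k - j) * P.mesh j)⁻¹ * (P.mesh j * (P.mesh j ^ P.d)⁻¹)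
      = ((P.L : ℝ) ^ (k - j)) ^ P.d / (P.L : ℝ) ^ (k - j) := by
    rw [mul_pow]
    field_simp
  rw [e]
  calc ((P.L : ℝ) ^ (k - j)) ^ P.d / (P.L : ℝ) ^ (k - j) ≤ ((P.L : ℝ) ^ (k - j)) ^ P.d := div_le_self (by positivity) hr
    _ ≤ ((P.L : ℝ) ^ (k - j)) ^ (P.d + 1) := pow_le_pow_right₀ hr (Nat.le_succ _)

/-- weight of the MIXED part: `((L^jε)^d)^{−1} ≤ ((L^kε)^d)^{−1}·(L^{k−j})^{d+1}`. [cite: Balaban1983Higgs3, (2.10) p.426] -/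
theorem weightM_le {j : ℕ} (hjk : j ≤ k) :
    (P.mesh j ^ P.d)⁻¹ ≤ (P.mesh k ^ P.d)⁻¹ * ((P.L : ℝ) ^ (k - j)) ^ (P.d + 1) := by
  have hm : 0 < P.mesh j := P.mesh_pos j
  have hL1 : (1 : ℝ) ≤ P.L := by exact_mod_cast P.hL
  have hr : 1 ≤ (P.L : ℝ) ^ (k - j) := one_le_pow₀ hL1
  have hr0 : 0 < (P.L : ℝ) ^ (k - j) := by positivity
  have e : (P.mesh j ^ P.d)⁻¹ = (P.mesh k ^ P.d)⁻¹ * ((P.L : ℝ) ^ (k - j)) ^ P.d := by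
    rw [mesh_eq_sc_mul hjk, mul_pow, mul_inv, mul_assoc, mul_comm ((P.mesh j ^ P.d)⁻¹), ← mul_assoc,
      inv_mul_cancel₀ (by positivity), one_mul]
  rw [e]
  exact mul_le_mul_of_nonneg_left (pow_le_pow_right₀ hr (Nat.le_succ _)) (by have := P.mesh_pos k; positivity)

/-- weight of the HÖLDER part: `(L^{k−j})^α·(L^kε)^d(L^kε)^{−1}(L^jε)((L^jε)^d)^{−1} ≤ (L^{k−j})^{d+1}` (`0 ≤ α ≤ 1`).
[cite: Balaban1983Higgs3, (2.11) p.426] -/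
theorem weightH_le {j : ℕ} (hjk : j ≤ k) {α : ℝ} (hα1 : α ≤ 1) :
    ((P.L : ℝ) ^ (k - j)) ^ α * (P.mesh k ^ P.d * (P.mesh k)⁻¹ * (P.mesh j * (P.mesh j ^ P.d)⁻¹))
      ≤ 1 * ((P.L : ℝ) ^ (k - j)) ^ (P.d + 1) := by
  have hL1 : (1 : ℝ) ≤ P.L := by exact_mod_cast P.hL
  have hr : 1 ≤ (P.L : ℝ) ^ (k - j) := one_le_pow₀ hL1
  have hr0 : 0 < (P.L : ℝ) ^ (k - j) := by positivity
  have hα : ((P.L : ℝ) ^ (k - j)) ^ α ≤ (P.L : ℝ) ^ (k - j) := by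
    conv_rhs => rw [← Real.rpow_one ((P.L : ℝ) ^ (k - j))]
    exact Real.rpow_le_rpow_of_exponent_le hr hα1
  have hw := weightD_le (P := P) hjk
  rw [one_mul] at hw ⊢
  have h0 : 0 ≤ P.mesh k ^ P.d * (P.mesh k)⁻¹ * (P.mesh j * (P.mesh j ^ P.d)⁻¹) := by
    have := P.mesh_pos k; have := P.mesh_pos j; positivity
  calc ((P.L : ℝ) ^ (k - j)) ^ α * (P.mesh k ^ P.d * (P.mesh k)⁻¹ * (P.mesh j * (P.mesh j ^ P.d)⁻¹))
      ≤ (P.L : ℝ) ^ (k - j) * (((P.L : ℝ) ^ (k - j)) ^ P.d / (P.L : ℝ) ^ (k - j)) := by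
        refine mul_le_mul hα ?_ h0 hr0.le
        have hm : 0 < P.mesh j := P.mesh_pos j
        rw [mesh_eq_sc_mul hjk, mul_pow]
        apply le_of_eq
        field_simp
    _ = ((P.L : ℝ) ^ (k - j)) ^ P.d := mul_div_cancel₀ _ hr0.ne'
    _ ≤ ((P.L : ℝ) ^ (k - j)) ^ (P.d + 1) := pow_le_pow_right₀ hr (Nat.le_succ _)

variable {C : ChargeData N} {A : HiggsLattice.VecField P 0} {msq a : ℝ}

/-- **Part 1 — the kernel on `□(v) × □(v′)`**: `|G_k(T_η,A;x,x′)| ≤ C_V·Φ·e^{−(δL/2)dist(□(v),□(v′))}`, from the value clause of (2.10)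
for every piece, summed over the pieces at separated arguments. [cite: Balaban1983Higgs3, (3.1) p.432] [cite: Balaban1983Higgs3, (2.10) p.426] -/
theorem sup_part_le (hL2 : 2 ≤ P.L) (hm : 0 ≤ msq) (ha : 0 < a) (hk1 : 1 ≤ k) (hkK : k ≤ P.K) {δ CV : ℝ} (hδ : 0 < δ)
    (hCV : 0 ≤ CV)
    (hV : ∀ (j : ℕ) (x x' : HiggsLattice.Site P 0),
      (P.mesh 0 ^ P.d)⁻¹ * ∑ i' : Ix N, ‖pieceA C A msq a k j (cb P N 0 (x', i')) x‖
        ≤ CV * (P.mesh j ^ 2 * (P.mesh j ^ P.d)⁻¹) * Real.exp (-(δ * ((HiggsLattice.Site.tdist x x' : ℝ) / (P.L : ℝ) ^ j))))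
    {v v' : HiggsLattice.Site P k} (h1 : 1 ≤ cubeDist k v v') {z : PSite P} (hz : z ∈ sites k v v') :
    ‖kerF C A msq a k z‖ ≤ CV * phiSum P.L (P.d + 1) δ * Real.exp (-(δ * P.L / 2 * cubeDist k v v')) := by
  obtain ⟨hx, hx'⟩ := mem_sites.1 hz
  have hL1 : 1 < P.L := by omega
  have hDc : cubeDist k v v' ≤ (HiggsLattice.Site.tdist z.1 z.2 : ℝ) / (P.L : ℝ) ^ k := cubeDist_le_sepD hkK hx hx' h1
  have hD1 : 1 ≤ (HiggsLattice.Site.tdist z.1 z.2 : ℝ) / (P.L : ℝ) ^ k := h1.trans hDc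
  have hU : 0 ≤ P.mesh k ^ P.d * (P.mesh k ^ 2)⁻¹ := by have := P.mesh_pos k; positivity
  -- the kernel below the pieces (2.6)
  have hker : ‖kerF C A msq a k z‖
      ≤ ∑ j ∈ Finset.range k, P.mesh k ^ P.d * (P.mesh k ^ 2)⁻¹ *
          ((P.mesh 0 ^ P.d)⁻¹ * ∑ i' : Ix N, ‖pieceA C A msq a k j (cb P N 0 (z.2, i')) z.1‖) := by
    rw [kerF, norm_smul, Real.norm_eq_abs, abs_of_pos (unitV_pos P k)]
    calc unitV P k * ‖blockK C A msq a k z.1 z.2‖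
        ≤ unitV P k * ∑ i' : Ix N, ∑ j ∈ Finset.range k, ‖pieceA C A msq a k j (cb P N 0 (z.2, i')) z.1‖ :=
          mul_le_mul_of_nonneg_left ((norm_blockK_le z.1 z.2).trans (Finset.sum_le_sum fun i' _ =>
            norm_G_apply_le_sum C A msq a hm ha hL1 hk1 hkK _ z.1)) (unitV_pos P k).le
      _ = _ := by
          rw [Finset.sum_comm, unitV, Finset.mul_sum]
          exact Finset.sum_congr rfl fun j _ => mul_assoc _ _ _
  refine hker.trans ?_
  have hmain := sum_pieces_sep_le' (k := k) hL2 (p := P.d + 1) hCV zero_le_one hδ hD1 hDc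
    (fun j => P.mesh k ^ P.d * (P.mesh k ^ 2)⁻¹ *
      ((P.mesh 0 ^ P.d)⁻¹ * ∑ i' : Ix N, ‖pieceA C A msq a k j (cb P N 0 (z.2, i')) z.1‖))
    (fun j => P.mesh k ^ P.d * (P.mesh k ^ 2)⁻¹ * (P.mesh j ^ 2 * (P.mesh j ^ P.d)⁻¹)) ?_ ?_
  · rw [mul_one] at hmain; exact hmain
  · intro j hj
    have h := mul_le_mul_of_nonneg_left (hV j z.1 z.2) hU
    rw [div_pow_eq_div_mul_sc (le_of_lt hj)] at h
    refine h.trans (le_of_eq ?_); ring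
  · intro j hj; exact weightV_le (le_of_lt hj)

/-- **Part 2 — the covariant derivatives on the product bonds**: `|D^η_{A}G_k(T_η,A;·,·)(c)| ≤ C_V·Φ·e^{−(δL/2)dist(□(v),□(v′))}` for
row AND column bonds (a column derivative is a row derivative of the transposed kernel), from the derivative clause of (2.10) for every
piece. [cite: Balaban1983Higgs3, (3.1) p.432] [cite: Balaban1983Higgs3, (2.10) p.426] -/
theorem deriv_part_le (hL2 : 2 ≤ P.L) (hm : 0 ≤ msq) (ha : 0 < a) (hk1 : 1 ≤ k) (hkK : k ≤ P.K) {δ CV : ℝ} (hδ : 0 < δ)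
    (hCV : 0 ≤ CV)
    (hDv : ∀ (j : ℕ) (μ : Fin P.d) (x x' : HiggsLattice.Site P 0),
      (P.mesh 0 ^ P.d)⁻¹ * ∑ i' : Ix N, ‖covDeriv C A (pieceA C A msq a k j (cb P N 0 (x', i'))) ⟨x, μ⟩‖
        ≤ CV * (P.mesh j * (P.mesh j ^ P.d)⁻¹) * Real.exp (-(δ * ((HiggsLattice.Site.tdist x x' : ℝ) / (P.L : ℝ) ^ j))))
    {v v' : HiggsLattice.Site P k} (h1 : 1 ≤ cubeDist k v v') {c : PBd P} (hc : c ∈ bonds k v v') :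
    ‖derivF C A msq a k c‖ ≤ CV * phiSum P.L (P.d + 1) δ * Real.exp (-(δ * P.L / 2 * cubeDist k v v')) := by
  obtain ⟨hbs, -, hy, -, -⟩ := bonds_spec hc
  rw [← cubeDist_cubeB_cubeY v v' c] at h1 ⊢
  unfold derivF
  generalize cubeB v v' c = vb at hbs h1 ⊢
  generalize cubeY v v' c = vy at hy h1 ⊢
  generalize (hb c).1 = b at hbs ⊢
  generalize (hb c).2 = y at hy ⊢
  obtain ⟨x, μ⟩ := b
  have hL1 : 1 < P.L := by omega
  have hDc : cubeDist k vb vy ≤ (HiggsLattice.Site.tdist x y : ℝ) / (P.L : ℝ) ^ k := cubeDist_le_sepD hkK hbs hy h1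
  have hD1 : 1 ≤ (HiggsLattice.Site.tdist x y : ℝ) / (P.L : ℝ) ^ k := h1.trans hDc
  have hU : 0 ≤ P.mesh k ^ P.d * (P.mesh k)⁻¹ := by have := P.mesh_pos k; positivity
  have hker : ‖unitD P k • blockDK C A msq a k ⟨x, μ⟩ y‖
      ≤ ∑ j ∈ Finset.range k, P.mesh k ^ P.d * (P.mesh k)⁻¹ *
          ((P.mesh 0 ^ P.d)⁻¹ * ∑ i' : Ix N, ‖covDeriv C A (pieceA C A msq a k j (cb P N 0 (y, i'))) ⟨x, μ⟩‖) := by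
    rw [norm_smul, Real.norm_eq_abs, abs_of_pos (unitD_pos P k)]
    calc unitD P k * ‖blockDK C A msq a k ⟨x, μ⟩ y‖
        ≤ unitD P k * ∑ i' : Ix N, ∑ j ∈ Finset.range k, ‖covDeriv C A (pieceA C A msq a k j (cb P N 0 (y, i'))) ⟨x, μ⟩‖ :=
          mul_le_mul_of_nonneg_left ((norm_blockDK_le _ y).trans (Finset.sum_le_sum fun i' _ =>
            norm_covDeriv_G_apply_le_sum C A msq a hm ha hL1 hk1 hkK _ _)) (unitD_pos P k).le
      _ = _ := by
          rw [Finset.sum_comm, unitD, Finset.mul_sum]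
          exact Finset.sum_congr rfl fun j _ => mul_assoc _ _ _
  refine hker.trans ?_
  have hmain := sum_pieces_sep_le' (k := k) hL2 (p := P.d + 1) hCV zero_le_one hδ hD1 hDc
    (fun j => P.mesh k ^ P.d * (P.mesh k)⁻¹ *
      ((P.mesh 0 ^ P.d)⁻¹ * ∑ i' : Ix N, ‖covDeriv C A (pieceA C A msq a k j (cb P N 0 (y, i'))) ⟨x, μ⟩‖))
    (fun j => P.mesh k ^ P.d * (P.mesh k)⁻¹ * (P.mesh j * (P.mesh j ^ P.d)⁻¹)) ?_ ?_
  · rw [mul_one] at hmain; exact hmain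
  · intro j hj
    have h := mul_le_mul_of_nonneg_left (hDv j μ x y) hU
    rw [div_pow_eq_div_mul_sc (le_of_lt hj)] at h
    refine h.trans (le_of_eq ?_); ring
  · intro j hj; exact weightD_le (le_of_lt hj)

/-- **Part 3a — the column move** `(DG^ε_k)(b,y₂)∘U(A(Γ_{y₁,y₂}))^* − (DG^ε_k)(b,y₁)` for `b` over `□(v_b)`, `y₁, y₂ ∈ □(v_y)`: bounded by
`d|y₁−y₂|·M_×`, `M_× = ε^dε·C_M(L^kε)^{−d}Φe^{−(δL/2)dist}` the bound of the twice-differentiated kernel ((2.10), mixed clause) on the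
bonds of `□(v_y)` (the contour stays in the cube). [cite: Balaban1983Higgs3, (1.32) p.420] [cite: Balaban1983Higgs3, (2.10) p.426] -/
theorem termA_le (hS : ∀ μ, 2 < P.sitesPerDir 0 μ) (hL2 : 2 ≤ P.L) (hm : 0 ≤ msq) (ha : 0 < a) (hk1 : 1 ≤ k) (hkK : k ≤ P.K)
    {δ CM : ℝ} (hδ : 0 < δ) (hCM : 0 ≤ CM)
    (hM : ∀ (j : ℕ) (μ ν : Fin P.d) (x x' : HiggsLattice.Site P 0),
      mixedTerm C A msq a k j μ ν x x'
        ≤ CM * (P.mesh j ^ P.d)⁻¹ * Real.exp (-(δ * ((HiggsLattice.Site.tdist x x' : ℝ) / (P.L : ℝ) ^ j))))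
    {vb vy : HiggsLattice.Site P k} (h1 : 1 ≤ cubeDist k vb vy) {b : HiggsLattice.PBond P 0} (hbv : blockIter k b.src = vb)
    {y₁ y₂ : HiggsLattice.Site P 0} (hy₁ : blockIter k y₁ = vy) (hy₂ : blockIter k y₂ = vy) :
    ‖(blockDK C A msq a k b y₂).comp (star (hol C A y₁ (cpath y₁ y₂))) - blockDK C A msq a k b y₁‖
      ≤ (P.d : ℝ) * (HiggsLattice.Site.tdist y₁ y₂ : ℝ) *
          (P.mesh 0 ^ P.d * P.mesh 0 *
            (CM * (P.mesh k ^ P.d)⁻¹ * phiSum P.L (P.d + 1) δ * Real.exp (-(δ * P.L / 2 * cubeDist k vb vy)))) := by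
  classical
  obtain ⟨xb, ν⟩ := b
  replace hbv : blockIter k xb = vb := hbv
  have hL1 : 1 < P.L := by omega
  have hε : 0 ≤ P.mesh 0 ^ P.d * P.mesh 0 := by have := P.mesh_pos 0; positivity
  obtain ⟨Mx, hMx⟩ : ∃ Mx : ℝ, Mx = P.mesh 0 ^ P.d * P.mesh 0 *
      (CM * (P.mesh k ^ P.d)⁻¹ * phiSum P.L (P.d + 1) δ * Real.exp (-(δ * P.L / 2 * cubeDist k vb vy))) := ⟨_, rfl⟩
  have hMx0 : 0 ≤ Mx := by
    rw [hMx]; have := P.mesh_pos k; have := phiSum_pos (L := P.L) (P.d + 1) hδ; positivity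
  obtain ⟨Ω, hΩ⟩ : ∃ Ω : Finset (HiggsLattice.Site P 0), Ω = Finset.univ.filter fun z => blockIter k z = vy := ⟨_, rfl⟩
  have hadm := isAdm_cpath y₁ y₂
  -- the column field's covariant derivatives on the bonds of `□(v_y)`
  have hD : ∀ (c : HiggsLattice.PBond P 0) (w : E N), c.src ∈ Ω → c.tgt ∈ Ω →
      ‖covDeriv C A (propagatorK C Finset.univ A msq a k (dip C A ⟨xb, ν⟩ w)) c‖ ≤ Mx * ‖w‖ := by
    intro c w hc _
    obtain ⟨xc, μ⟩ := c
    have hcv : blockIter k xc = vy := by rw [hΩ, Finset.mem_filter] at hc; exact hc.2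
    have h1' : 1 ≤ cubeDist k vy vb := by rwa [cubeDist_comm]
    have hDc : cubeDist k vb vy ≤ (HiggsLattice.Site.tdist xc xb : ℝ) / (P.L : ℝ) ^ k := by
      rw [cubeDist_comm]; exact cubeDist_le_sepD hkK hcv hbv h1'
    have hD1 : 1 ≤ (HiggsLattice.Site.tdist xc xb : ℝ) / (P.L : ℝ) ^ k := h1'.trans (cubeDist_le_sepD hkK hcv hbv h1')
    have hsum : ∑ i : Ix N, ‖covDeriv C A (propagatorK C Finset.univ A msq a k (dip C A ⟨xb, ν⟩ (onb N i))) ⟨xc, μ⟩‖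
        ≤ ∑ j ∈ Finset.range k, P.mesh 0 ^ P.d * P.mesh 0 * mixedTerm C A msq a k j μ ν xc xb := by
      calc ∑ i : Ix N, ‖covDeriv C A (propagatorK C Finset.univ A msq a k (dip C A ⟨xb, ν⟩ (onb N i))) ⟨xc, μ⟩‖
          ≤ ∑ i : Ix N, ∑ j ∈ Finset.range k, ‖covDeriv C A (pieceA C A msq a k j (dip C A ⟨xb, ν⟩ (onb N i))) ⟨xc, μ⟩‖ :=
            Finset.sum_le_sum fun i _ => norm_covDeriv_G_apply_le_sum C A msq a hm ha hL1 hk1 hkK _ _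
        _ = _ := by
            rw [Finset.sum_comm]
            refine Finset.sum_congr rfl fun j _ => ?_
            have hε0 : P.mesh 0 ≠ 0 := (P.mesh_pos 0).ne'
            rw [mixedTerm]
            field_simp
    calc ‖covDeriv C A (propagatorK C Finset.univ A msq a k (dip C A ⟨xb, ν⟩ w)) ⟨xc, μ⟩‖
        ≤ ‖w‖ * ∑ i : Ix N, ‖covDeriv C A (propagatorK C Finset.univ A msq a k (dip C A ⟨xb, ν⟩ (onb N i))) ⟨xc, μ⟩‖ :=
          norm_covDeriv_dip_le_sum (propagatorK C Finset.univ A msq a k) _ _ w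
      _ ≤ ‖w‖ * ∑ j ∈ Finset.range k, P.mesh 0 ^ P.d * P.mesh 0 * mixedTerm C A msq a k j μ ν xc xb :=
          mul_le_mul_of_nonneg_left hsum (norm_nonneg _)
      _ ≤ ‖w‖ * Mx := by
          refine mul_le_mul_of_nonneg_left ?_ (norm_nonneg _)
          have hmain := sum_pieces_sep_le' (k := k) hL2 (p := P.d + 1) (mul_nonneg hε hCM)
            (inv_nonneg.mpr (pow_nonneg (P.mesh_pos k).le P.d)) hδ hD1 hDc
            (fun j => P.mesh 0 ^ P.d * P.mesh 0 * mixedTerm C A msq a k j μ ν xc xb) (fun j => (P.mesh j ^ P.d)⁻¹) ?_ ?_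
          · refine hmain.trans (le_of_eq ?_); rw [hMx]; ring
          · intro j hj
            have h := mul_le_mul_of_nonneg_left (hM j μ ν xc xb) hε
            rw [div_pow_eq_div_mul_sc (le_of_lt hj)] at h
            refine h.trans (le_of_eq ?_); ring
          · intro j hj; exact weightM_le (le_of_lt hj)
      _ = Mx * ‖w‖ := mul_comm _ _
  have h := norm_blockDK_comp_star_sub_le (msq := msq) (a := a) (k := k) hS ⟨xb, ν⟩ Ω hMx0 hD hadm.1
    (fun z hz => by rw [hΩ, Finset.mem_filter]; exact ⟨Finset.mem_univ _, blockIter_eq_of_mem_cpath hkK hy₁ hy₂ z hz⟩)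
  rw [pathEnd_cpath] at h
  rw [← hMx]
  exact h.trans (mul_le_mul_of_nonneg_right hadm.2.2 hMx0)

/-- **Part 3b — the row move** `U(A(Γ_{x₁,x₂}))(DG^ε_k)(⟨x₂,μ⟩,y) − (DG^ε_k)(⟨x₁,μ⟩,y)` in the print's units, `x₁, x₂ ∈ □(v_b)`, `y ∈ □(v_y)`:
bounded by `p^α·C_H·Φ·e^{−(δL/2)dist}` for any `p ≥ |x₁−x₂|/L^k`, from (2.11) for every piece along the contour `Γ_{x₁,x₂}`.
[cite: Balaban1983Higgs3, (1.32) p.420] [cite: Balaban1983Higgs3, (2.11) p.426] -/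
theorem termB_le (hL2 : 2 ≤ P.L) (hm : 0 ≤ msq) (ha : 0 < a) (hk1 : 1 ≤ k) (hkK : k ≤ P.K) {α δ CH : ℝ} (hα0 : 0 ≤ α)
    (hα1 : α ≤ 1) (hδ : 0 < δ) (hCH : 0 ≤ CH)
    (hH : ∀ (j : ℕ) (μ : Fin P.d) (x₁ x₂ x : HiggsLattice.Site P 0) (Γ : List (HiggsLattice.Site P 0)), x₁ ≠ x₂ →
      IsAdm x₁ x₂ Γ →
      holderTerm C A msq a k j μ x₁ x₂ x Γ
        ≤ (P.mesh 0 * (HiggsLattice.Site.tdist x₁ x₂ : ℝ)) ^ α *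
          (CH * (P.mesh j * (P.mesh j ^ P.d)⁻¹ * (P.mesh j ^ α)⁻¹) *
            Real.exp (-(δ * (min (HiggsLattice.Site.tdist x₁ x : ℝ) (HiggsLattice.Site.tdist x₂ x : ℝ) / (P.L : ℝ) ^ j)))))
    {vb vy : HiggsLattice.Site P k} (h1 : 1 ≤ cubeDist k vb vy) {x₁ x₂ y : HiggsLattice.Site P 0} (μ : Fin P.d)
    (hx₁ : blockIter k x₁ = vb) (hx₂ : blockIter k x₂ = vb) (hy : blockIter k y = vy) {pd : ℝ}
    (hpd : (HiggsLattice.Site.tdist x₁ x₂ : ℝ) / (P.L : ℝ) ^ k ≤ pd) :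
    unitD P k * ‖(hol C A x₁ (cpath x₁ x₂)).comp (blockDK C A msq a k ⟨x₂, μ⟩ y) - blockDK C A msq a k ⟨x₁, μ⟩ y‖
      ≤ pd ^ α * (CH * phiSum P.L (P.d + 1) δ * Real.exp (-(δ * P.L / 2 * cubeDist k vb vy))) := by
  have hL1 : 1 < P.L := by omega
  have hL0 : (0 : ℝ) < P.L := by exact_mod_cast (by omega : 0 < P.L)
  have hLk : (0 : ℝ) < (P.L : ℝ) ^ k := pow_pos hL0 k
  have hpd0 : 0 ≤ pd := le_trans (by positivity) hpd
  have hΦ := phiSum_pos (L := P.L) (P.d + 1) hδ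
  by_cases hx : x₁ = x₂
  · subst hx
    rw [cpath_self, hol_nil, ContinuousLinearMap.one_def, ContinuousLinearMap.id_comp, sub_self, norm_zero, mul_zero]
    positivity
  have hDc : cubeDist k vb vy
      ≤ min (HiggsLattice.Site.tdist x₁ y : ℝ) (HiggsLattice.Site.tdist x₂ y : ℝ) / (P.L : ℝ) ^ k := by
    rcases min_choice (HiggsLattice.Site.tdist x₁ y : ℝ) (HiggsLattice.Site.tdist x₂ y : ℝ) with h | h <;> rw [h]
    · exact cubeDist_le_sepD hkK hx₁ hy h1
    · exact cubeDist_le_sepD hkK hx₂ hy h1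
  have hD1 : 1 ≤ min (HiggsLattice.Site.tdist x₁ y : ℝ) (HiggsLattice.Site.tdist x₂ y : ℝ) / (P.L : ℝ) ^ k := h1.trans hDc
  have hU : 0 ≤ P.mesh k ^ P.d * (P.mesh k)⁻¹ := by have := P.mesh_pos k; positivity
  -- below the pieces (2.6)
  have hstep : unitD P k * ‖(hol C A x₁ (cpath x₁ x₂)).comp (blockDK C A msq a k ⟨x₂, μ⟩ y) - blockDK C A msq a k ⟨x₁, μ⟩ y‖
      ≤ ∑ j ∈ Finset.range k, P.mesh k ^ P.d * (P.mesh k)⁻¹ * holderTerm C A msq a k j μ x₁ x₂ y (cpath x₁ x₂) := by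
    calc unitD P k * ‖(hol C A x₁ (cpath x₁ x₂)).comp (blockDK C A msq a k ⟨x₂, μ⟩ y) - blockDK C A msq a k ⟨x₁, μ⟩ y‖
        ≤ unitD P k * ∑ i' : Ix N, ∑ j ∈ Finset.range k,
            ‖hol C A x₁ (cpath x₁ x₂) (covDeriv C A (pieceA C A msq a k j (cb P N 0 (y, i'))) ⟨x₂, μ⟩)
              - covDeriv C A (pieceA C A msq a k j (cb P N 0 (y, i'))) ⟨x₁, μ⟩‖ :=
          mul_le_mul_of_nonneg_left ((norm_hol_comp_blockDK_sub_le x₁ x₂ y _ μ).trans (Finset.sum_le_sum fun i' _ =>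
            norm_hol_covDeriv_G_sub_le_sum C A msq a hm ha hL1 hk1 hkK _ x₁ x₂ _ μ)) (unitD_pos P k).le
      _ = _ := by
          rw [Finset.sum_comm, unitD, Finset.mul_sum]
          refine Finset.sum_congr rfl fun j _ => ?_
          rw [holderTerm, mul_assoc]
  refine hstep.trans ?_
  have hmain := sum_pieces_sep_le' (k := k) hL2 (p := P.d + 1) (mul_nonneg (Real.rpow_nonneg hpd0 α) hCH) zero_le_one hδ
    hD1 hDc (fun j => P.mesh k ^ P.d * (P.mesh k)⁻¹ * holderTerm C A msq a k j μ x₁ x₂ y (cpath x₁ x₂))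
    (fun j => ((P.L : ℝ) ^ (k - j)) ^ α * (P.mesh k ^ P.d * (P.mesh k)⁻¹ * (P.mesh j * (P.mesh j ^ P.d)⁻¹))) ?_ ?_
  · refine hmain.trans (le_of_eq ?_); ring
  · intro j hj
    have hjk := le_of_lt hj
    have h := mul_le_mul_of_nonneg_left (hH j μ x₁ x₂ y _ hx (isAdm_cpath x₁ x₂)) hU
    rw [div_pow_eq_div_mul_sc hjk] at h
    -- the Hölder weight in the print's units: `(ε|x₁−x₂|)^α(L^jε)^{−α} = (|x₁−x₂|/L^k·L^{k−j})^α ≤ p^α(L^{k−j})^α`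
    have hr0 : (0 : ℝ) ≤ (P.L : ℝ) ^ (k - j) := by positivity
    have hwt : (P.mesh 0 * (HiggsLattice.Site.tdist x₁ x₂ : ℝ)) ^ α * (P.mesh j ^ α)⁻¹
        ≤ pd ^ α * ((P.L : ℝ) ^ (k - j)) ^ α := by
      have hε := P.mesh_pos 0
      have hmj := P.mesh_pos j
      rw [← Real.inv_rpow hmj.le, ← Real.mul_rpow (by positivity) (inv_nonneg.mpr hmj.le), ← Real.mul_rpow hpd0 hr0]
      refine Real.rpow_le_rpow (by positivity) ?_ hα0
      have e : P.mesh 0 * (HiggsLattice.Site.tdist x₁ x₂ : ℝ) * (P.mesh j)⁻¹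
          = (HiggsLattice.Site.tdist x₁ x₂ : ℝ) / (P.L : ℝ) ^ k * (P.L : ℝ) ^ (k - j) := by
        rw [← div_pow_eq_div_mul_sc hjk, mesh_eq_pow_mul P j]
        have hε0 : P.mesh 0 ≠ 0 := hε.ne'
        have hLj : (P.L : ℝ) ^ j ≠ 0 := (pow_pos hL0 j).ne'
        field_simp
      rw [e]
      exact mul_le_mul_of_nonneg_right hpd hr0
    have hrest : 0 ≤ CH * (P.mesh k ^ P.d * (P.mesh k)⁻¹ * (P.mesh j * (P.mesh j ^ P.d)⁻¹)) *
        Real.exp (-(δ * (min (HiggsLattice.Site.tdist x₁ y : ℝ) (HiggsLattice.Site.tdist x₂ y : ℝ) / (P.L : ℝ) ^ k *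
          (P.L : ℝ) ^ (k - j)))) := by
      have := P.mesh_pos k; have := P.mesh_pos j; positivity
    calc P.mesh k ^ P.d * (P.mesh k)⁻¹ * holderTerm C A msq a k j μ x₁ x₂ y (cpath x₁ x₂)
        ≤ _ := h
      _ = (P.mesh 0 * (HiggsLattice.Site.tdist x₁ x₂ : ℝ)) ^ α * (P.mesh j ^ α)⁻¹ *
            (CH * (P.mesh k ^ P.d * (P.mesh k)⁻¹ * (P.mesh j * (P.mesh j ^ P.d)⁻¹)) *
              Real.exp (-(δ * (min (HiggsLattice.Site.tdist x₁ y : ℝ) (HiggsLattice.Site.tdist x₂ y : ℝ) / (P.L : ℝ) ^ k *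
                (P.L : ℝ) ^ (k - j))))) := by ring
      _ ≤ pd ^ α * ((P.L : ℝ) ^ (k - j)) ^ α *
            (CH * (P.mesh k ^ P.d * (P.mesh k)⁻¹ * (P.mesh j * (P.mesh j ^ P.d)⁻¹)) *
              Real.exp (-(δ * (min (HiggsLattice.Site.tdist x₁ y : ℝ) (HiggsLattice.Site.tdist x₂ y : ℝ) / (P.L : ℝ) ^ k *
                (P.L : ℝ) ^ (k - j))))) := mul_le_mul_of_nonneg_right hwt hrest
      _ = _ := by ring
  · intro j hj; exact weightH_le (le_of_lt hj) hα1

/-- **Part 3, the core estimate for one same-direction pair** in explicit variables: bonds `⟨x₁,μ⟩, ⟨x₂,μ⟩` over `□(v_b)`, other sites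
`y₁, y₂ ∈ □(v_y)`: `(L^kε)^{d−1}ε^{−d}‖U(A(Γ_{x₁,x₂}))(DG^ε_k)(⟨x₂,μ⟩,y₂)U(A(Γ_{y₁,y₂}))^* − (DG^ε_k)(⟨x₁,μ⟩,y₁)‖ ≤
(C_H + dC_M)Φe^{−(δL/2)dist}·(max(|x₁−x₂|,|y₁−y₂|)/L^k)^α` — triangle through `(DG^ε_k)(⟨x₂,μ⟩,y₁)`: column move (Part 3a, one factor
`|y₁−y₂|/L^k ≤ p ≤ p^α` as `p ≤ 1` inside a unit cube) plus row move (Part 3b). [cite: Balaban1983Higgs3, (3.1) p.432] -/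
theorem holder_core (hS : ∀ μ, 2 < P.sitesPerDir 0 μ) (hL2 : 2 ≤ P.L) (hm : 0 ≤ msq) (ha : 0 < a) (hk1 : 1 ≤ k) (hkK : k ≤ P.K)
    {α δ CH CM : ℝ} (hα0 : 0 ≤ α) (hα1 : α ≤ 1) (hδ : 0 < δ) (hCH : 0 ≤ CH) (hCM : 0 ≤ CM)
    (hH : ∀ (j : ℕ) (μ : Fin P.d) (x₁ x₂ x : HiggsLattice.Site P 0) (Γ : List (HiggsLattice.Site P 0)), x₁ ≠ x₂ →
      IsAdm x₁ x₂ Γ →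
      holderTerm C A msq a k j μ x₁ x₂ x Γ
        ≤ (P.mesh 0 * (HiggsLattice.Site.tdist x₁ x₂ : ℝ)) ^ α *
          (CH * (P.mesh j * (P.mesh j ^ P.d)⁻¹ * (P.mesh j ^ α)⁻¹) *
            Real.exp (-(δ * (min (HiggsLattice.Site.tdist x₁ x : ℝ) (HiggsLattice.Site.tdist x₂ x : ℝ) / (P.L : ℝ) ^ j)))))
    (hM : ∀ (j : ℕ) (μ ν : Fin P.d) (x x' : HiggsLattice.Site P 0),
      mixedTerm C A msq a k j μ ν x x'
        ≤ CM * (P.mesh j ^ P.d)⁻¹ * Real.exp (-(δ * ((HiggsLattice.Site.tdist x x' : ℝ) / (P.L : ℝ) ^ j))))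
    {vb vy : HiggsLattice.Site P k} (h1 : 1 ≤ cubeDist k vb vy) {x₁ x₂ y₁ y₂ : HiggsLattice.Site P 0} (μ : Fin P.d)
    (hx₁ : blockIter k x₁ = vb) (hx₂ : blockIter k x₂ = vb) (hy₁ : blockIter k y₁ = vy) (hy₂ : blockIter k y₂ = vy)
    (hpos : 0 < max (HiggsLattice.Site.tdist x₁ x₂ : ℝ) (HiggsLattice.Site.tdist y₁ y₂ : ℝ) / (P.L : ℝ) ^ k) :
    ‖(hol C A x₁ (cpath x₁ x₂)).comp
          ((unitD P k • blockDK C A msq a k ⟨x₂, μ⟩ y₂).comp (star (hol C A y₁ (cpath y₁ y₂))))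
        - unitD P k • blockDK C A msq a k ⟨x₁, μ⟩ y₁‖
      ≤ (CH + P.d * CM) * phiSum P.L (P.d + 1) δ * Real.exp (-(δ * P.L / 2 * cubeDist k vb vy)) *
          (max (HiggsLattice.Site.tdist x₁ x₂ : ℝ) (HiggsLattice.Site.tdist y₁ y₂ : ℝ) / (P.L : ℝ) ^ k) ^ α := by
  have hL0 : (0 : ℝ) < P.L := by exact_mod_cast (by omega : 0 < P.L)
  have hLk : (0 : ℝ) < (P.L : ℝ) ^ k := pow_pos hL0 k
  have hΦ := phiSum_pos (L := P.L) (P.d + 1) hδ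
  obtain ⟨pd, hpd⟩ : ∃ pd : ℝ,
      pd = max (HiggsLattice.Site.tdist x₁ x₂ : ℝ) (HiggsLattice.Site.tdist y₁ y₂ : ℝ) / (P.L : ℝ) ^ k := ⟨_, rfl⟩
  rw [← hpd] at hpos ⊢
  have htb : (HiggsLattice.Site.tdist x₁ x₂ : ℝ) / (P.L : ℝ) ^ k ≤ pd := by
    rw [hpd]; exact div_le_div_of_nonneg_right (le_max_left _ _) hLk.le
  have hty : (HiggsLattice.Site.tdist y₁ y₂ : ℝ) / (P.L : ℝ) ^ k ≤ pd := by
    rw [hpd]; exact div_le_div_of_nonneg_right (le_max_right _ _) hLk.le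
  have hpd1 : pd ≤ 1 := by
    rw [hpd, div_le_one hLk]
    have h₁ := tdist_le_of_same_cube hkK hx₁ hx₂
    have h₂ := tdist_le_of_same_cube hkK hy₁ hy₂
    exact max_le (by linarith) (by linarith)
  have hpdα : pd ≤ pd ^ α := by
    conv_lhs => rw [← Real.rpow_one pd]
    exact Real.rpow_le_rpow_of_exponent_ge hpos hpd1 hα1
  -- the unit out, the triangle through `(DG^ε_k)(⟨x₂,μ⟩,y₁)`
  have e : (hol C A x₁ (cpath x₁ x₂)).comp
          ((unitD P k • blockDK C A msq a k ⟨x₂, μ⟩ y₂).comp (star (hol C A y₁ (cpath y₁ y₂))))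
        - unitD P k • blockDK C A msq a k ⟨x₁, μ⟩ y₁
      = unitD P k • ((hol C A x₁ (cpath x₁ x₂)).comp
          ((blockDK C A msq a k ⟨x₂, μ⟩ y₂).comp (star (hol C A y₁ (cpath y₁ y₂))) - blockDK C A msq a k ⟨x₂, μ⟩ y₁) +
        ((hol C A x₁ (cpath x₁ x₂)).comp (blockDK C A msq a k ⟨x₂, μ⟩ y₁) - blockDK C A msq a k ⟨x₁, μ⟩ y₁)) := by
    rw [ContinuousLinearMap.smul_comp, ContinuousLinearMap.comp_smul, ContinuousLinearMap.comp_sub, sub_add_sub_cancel,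
      smul_sub]
  rw [e, norm_smul, Real.norm_eq_abs, abs_of_pos (unitD_pos P k)]
  have hA := termA_le (msq := msq) (a := a) hS hL2 hm ha hk1 hkK hδ hCM hM h1 (b := ⟨x₂, μ⟩) hx₂ hy₁ hy₂
  have hB := termB_le (msq := msq) (a := a) hL2 hm ha hk1 hkK hα0 hα1 hδ hCH hH h1 μ hx₁ hx₂ hy₁ htb
  have hu : unitD P k * (P.mesh 0 ^ P.d * P.mesh 0) * (P.mesh k ^ P.d)⁻¹ = ((P.L : ℝ) ^ k)⁻¹ := by
    unfold unitD
    rw [mesh_eq_pow_mul P k]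
    have hε0 : P.mesh 0 ≠ 0 := (P.mesh_pos 0).ne'
    have hLk0 : (P.L : ℝ) ^ k ≠ 0 := hLk.ne'
    field_simp
  -- name the two operator differences (column move `TA`, row move `TB`)
  obtain ⟨TA, hTA⟩ : ∃ T : E N →L[ℝ] E N,
      (blockDK C A msq a k ⟨x₂, μ⟩ y₂).comp (star (hol C A y₁ (cpath y₁ y₂))) - blockDK C A msq a k ⟨x₂, μ⟩ y₁ = T := ⟨_, rfl⟩
  obtain ⟨TB, hTB⟩ : ∃ T : E N →L[ℝ] E N,
      (hol C A x₁ (cpath x₁ x₂)).comp (blockDK C A msq a k ⟨x₂, μ⟩ y₁) - blockDK C A msq a k ⟨x₁, μ⟩ y₁ = T := ⟨_, rfl⟩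
  rw [hTA] at hA ⊢
  rw [hTB] at hB ⊢
  have hu0 := (unitD_pos P k).le
  have hX : ‖(hol C A x₁ (cpath x₁ x₂)).comp TA‖ ≤ ‖TA‖ := norm_hol_comp_le _ _ _
  have hK0 : 0 ≤ CM * phiSum P.L (P.d + 1) δ * Real.exp (-(δ * P.L / 2 * cubeDist k vb vy)) := by positivity
  calc unitD P k * ‖(hol C A x₁ (cpath x₁ x₂)).comp TA + TB‖
      ≤ unitD P k * (‖TA‖ + ‖TB‖) := mul_le_mul_of_nonneg_left ((norm_add_le _ _).trans (add_le_add hX le_rfl)) hu0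
    _ = unitD P k * ‖TA‖ + unitD P k * ‖TB‖ := mul_add _ _ _
    _ ≤ unitD P k * ((P.d : ℝ) * (HiggsLattice.Site.tdist y₁ y₂ : ℝ) * (P.mesh 0 ^ P.d * P.mesh 0 *
            (CM * (P.mesh k ^ P.d)⁻¹ * phiSum P.L (P.d + 1) δ * Real.exp (-(δ * P.L / 2 * cubeDist k vb vy))))) +
          pd ^ α * (CH * phiSum P.L (P.d + 1) δ * Real.exp (-(δ * P.L / 2 * cubeDist k vb vy))) :=
        add_le_add (mul_le_mul_of_nonneg_left hA hu0) hB
    _ = (P.d : ℝ) * ((HiggsLattice.Site.tdist y₁ y₂ : ℝ) * (unitD P k * (P.mesh 0 ^ P.d * P.mesh 0) * (P.mesh k ^ P.d)⁻¹)) *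
            (CM * phiSum P.L (P.d + 1) δ * Real.exp (-(δ * P.L / 2 * cubeDist k vb vy))) +
          pd ^ α * (CH * phiSum P.L (P.d + 1) δ * Real.exp (-(δ * P.L / 2 * cubeDist k vb vy))) := by ring
    _ = (P.d : ℝ) * ((HiggsLattice.Site.tdist y₁ y₂ : ℝ) / (P.L : ℝ) ^ k) *
            (CM * phiSum P.L (P.d + 1) δ * Real.exp (-(δ * P.L / 2 * cubeDist k vb vy))) +
          pd ^ α * (CH * phiSum P.L (P.d + 1) δ * Real.exp (-(δ * P.L / 2 * cubeDist k vb vy))) := by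
        rw [hu]; ring
    _ ≤ (P.d : ℝ) * pd ^ α * (CM * phiSum P.L (P.d + 1) δ * Real.exp (-(δ * P.L / 2 * cubeDist k vb vy))) +
          pd ^ α * (CH * phiSum P.L (P.d + 1) δ * Real.exp (-(δ * P.L / 2 * cubeDist k vb vy))) :=
        add_le_add (mul_le_mul_of_nonneg_right
          (mul_le_mul_of_nonneg_left (hty.trans hpdα) (Nat.cast_nonneg _)) hK0) le_rfl
    _ = _ := by ring

/-- **Part 3 — the Hölder quotients of (1.32) for the two-variable field**: for same-direction product bonds `c, c′` of `□(v) × □(v′)` at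
positive distance, `‖τ_{c,c′}(DF(c′)) − DF(c)‖ ≤ (C_H + dC_M)Φe^{−(δL/2)dist(□(v),□(v′))}·|z(c) − z(c′)|^α` (row pairs and column pairs
alike, by the symmetry of the kernel). [cite: Balaban1983Higgs3, (3.1) p.432] [cite: Balaban1983Higgs3, (1.32) p.420] -/
theorem holder_part_le (hS : ∀ μ, 2 < P.sitesPerDir 0 μ) (hL2 : 2 ≤ P.L) (hm : 0 ≤ msq) (ha : 0 < a) (hk1 : 1 ≤ k)
    (hkK : k ≤ P.K) {α δ CH CM : ℝ} (hα0 : 0 ≤ α) (hα1 : α ≤ 1) (hδ : 0 < δ) (hCH : 0 ≤ CH) (hCM : 0 ≤ CM)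
    (hH : ∀ (j : ℕ) (μ : Fin P.d) (x₁ x₂ x : HiggsLattice.Site P 0) (Γ : List (HiggsLattice.Site P 0)), x₁ ≠ x₂ →
      IsAdm x₁ x₂ Γ →
      holderTerm C A msq a k j μ x₁ x₂ x Γ
        ≤ (P.mesh 0 * (HiggsLattice.Site.tdist x₁ x₂ : ℝ)) ^ α *
          (CH * (P.mesh j * (P.mesh j ^ P.d)⁻¹ * (P.mesh j ^ α)⁻¹) *
            Real.exp (-(δ * (min (HiggsLattice.Site.tdist x₁ x : ℝ) (HiggsLattice.Site.tdist x₂ x : ℝ) / (P.L : ℝ) ^ j)))))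
    (hM : ∀ (j : ℕ) (μ ν : Fin P.d) (x x' : HiggsLattice.Site P 0),
      mixedTerm C A msq a k j μ ν x x'
        ≤ CM * (P.mesh j ^ P.d)⁻¹ * Real.exp (-(δ * ((HiggsLattice.Site.tdist x x' : ℝ) / (P.L : ℝ) ^ j))))
    {v v' : HiggsLattice.Site P k} (h1 : 1 ≤ cubeDist k v v') {c c' : PBd P} (hc : c ∈ bonds k v v') (hc' : c' ∈ bonds k v v')
    (hdir : dirOf c = dirOf c') (hpos : 0 < pdist k (baseOf c) (baseOf c')) :
    ‖transp C A c c' (derivF C A msq a k c') - derivF C A msq a k c‖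
      ≤ (CH + P.d * CM) * phiSum P.L (P.d + 1) δ * Real.exp (-(δ * P.L / 2 * cubeDist k v v')) *
          pdist k (baseOf c) (baseOf c') ^ α := by
  obtain ⟨hcx₁, -, hcy₁, -, -⟩ := bonds_spec hc
  obtain ⟨hcx₂, -, hcy₂, -, -⟩ := bonds_spec hc'
  rcases c with ⟨μ, x₁, y₁⟩ | ⟨μ, y₁, x₁⟩ <;> rcases c' with ⟨μ', x₂, y₂⟩ | ⟨μ', y₂, x₂⟩ <;>
    simp only [dirOf, Sum.elim_inl, Sum.elim_inr, Sum.inl.injEq, Sum.inr.injEq, reduceCtorEq] at hdir <;> subst hdir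
  · -- a ROW pair: bonds over `□(v)`, other sites in `□(v′)`
    simp only [hb, cubeB, cubeY, Sum.elim_inl] at hcx₁ hcy₁ hcx₂ hcy₂
    exact holder_core hS hL2 hm ha hk1 hkK hα0 hα1 hδ hCH hCM hH hM h1 μ hcx₁ hcx₂ hcy₁ hcy₂ hpos
  · -- a COLUMN pair: bonds over `□(v′)`, other sites in `□(v)`
    simp only [hb, cubeB, cubeY, Sum.elim_inr] at hcx₁ hcy₁ hcx₂ hcy₂
    have h1' : 1 ≤ cubeDist k v' v := by rwa [cubeDist_comm]
    change 0 < max (HiggsLattice.Site.tdist y₁ y₂ : ℝ) (HiggsLattice.Site.tdist x₁ x₂ : ℝ) / (P.L : ℝ) ^ k at hpos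
    rw [max_comm] at hpos
    have h := holder_core hS hL2 hm ha hk1 hkK hα0 hα1 hδ hCH hCM hH hM h1' μ hcx₁ hcx₂ hcy₁ hcy₂ hpos
    rw [cubeDist_comm] at h
    change _ ≤ _ * (max (HiggsLattice.Site.tdist y₁ y₂ : ℝ) (HiggsLattice.Site.tdist x₁ x₂ : ℝ) / (P.L : ℝ) ^ k) ^ α
    rw [max_comm]
    exact h

/-- **`‖hG_k(T_η,A)h′‖_{1,α} ≤ (2C_V + C_H + dC_M)·Φ·e^{−(δL/2)dist(□(v),□(v′))}`** given the four model-form inputs (value, derivative,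
Hölder, mixed) with a common rate `δ`. [cite: Balaban1983Higgs3, (3.1) p.432] -/
theorem normHGH_le (hS : ∀ μ, 2 < P.sitesPerDir 0 μ) (hL2 : 2 ≤ P.L) (hm : 0 ≤ msq) (ha : 0 < a) (hk1 : 1 ≤ k) (hkK : k ≤ P.K)
    {α δ CV CH CM : ℝ} (hα0 : 0 ≤ α) (hα1 : α ≤ 1) (hδ : 0 < δ) (hCV : 0 ≤ CV) (hCH : 0 ≤ CH) (hCM : 0 ≤ CM)
    (hV : ∀ (j : ℕ) (x x' : HiggsLattice.Site P 0),
      (P.mesh 0 ^ P.d)⁻¹ * ∑ i' : Ix N, ‖pieceA C A msq a k j (cb P N 0 (x', i')) x‖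
        ≤ CV * (P.mesh j ^ 2 * (P.mesh j ^ P.d)⁻¹) * Real.exp (-(δ * ((HiggsLattice.Site.tdist x x' : ℝ) / (P.L : ℝ) ^ j))))
    (hDv : ∀ (j : ℕ) (μ : Fin P.d) (x x' : HiggsLattice.Site P 0),
      (P.mesh 0 ^ P.d)⁻¹ * ∑ i' : Ix N, ‖covDeriv C A (pieceA C A msq a k j (cb P N 0 (x', i'))) ⟨x, μ⟩‖
        ≤ CV * (P.mesh j * (P.mesh j ^ P.d)⁻¹) * Real.exp (-(δ * ((HiggsLattice.Site.tdist x x' : ℝ) / (P.L : ℝ) ^ j))))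
    (hH : ∀ (j : ℕ) (μ : Fin P.d) (x₁ x₂ x : HiggsLattice.Site P 0) (Γ : List (HiggsLattice.Site P 0)), x₁ ≠ x₂ →
      IsAdm x₁ x₂ Γ →
      holderTerm C A msq a k j μ x₁ x₂ x Γ
        ≤ (P.mesh 0 * (HiggsLattice.Site.tdist x₁ x₂ : ℝ)) ^ α *
          (CH * (P.mesh j * (P.mesh j ^ P.d)⁻¹ * (P.mesh j ^ α)⁻¹) *
            Real.exp (-(δ * (min (HiggsLattice.Site.tdist x₁ x : ℝ) (HiggsLattice.Site.tdist x₂ x : ℝ) / (P.L : ℝ) ^ j)))))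
    (hM : ∀ (j : ℕ) (μ ν : Fin P.d) (x x' : HiggsLattice.Site P 0),
      mixedTerm C A msq a k j μ ν x x'
        ≤ CM * (P.mesh j ^ P.d)⁻¹ * Real.exp (-(δ * ((HiggsLattice.Site.tdist x x' : ℝ) / (P.L : ℝ) ^ j))))
    {v v' : HiggsLattice.Site P k} (h1 : 1 ≤ cubeDist k v v') :
    normHGH C A msq a k α v v'
      ≤ (2 * CV + CH + P.d * CM) * phiSum P.L (P.d + 1) δ * Real.exp (-(δ * P.L / 2 * cubeDist k v v')) := by
  have hΦ := phiSum_pos (L := P.L) (P.d + 1) hδ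
  have h₁ := supNorm_le (S := sites k v v') (f := kerF C A msq a k) (by positivity)
    fun z hz => sup_part_le hL2 hm ha hk1 hkK hδ hCV hV h1 hz
  have h₂ := supNorm_le (S := bonds k v v') (f := derivF C A msq a k) (by positivity)
    fun c hc => deriv_part_le hL2 hm ha hk1 hkK hδ hCV hDv h1 hc
  have h₃ := holderSeminorm_le (α := α) (adm := fun c c' : PBd P => dirOf c = dirOf c')
    (dist := fun c c' => pdist k (baseOf c) (baseOf c')) (τ := transp C A) (S := bonds k v v') (f := derivF C A msq a k)
    (C := (CH + P.d * CM) * phiSum P.L (P.d + 1) δ * Real.exp (-(δ * P.L / 2 * cubeDist k v v'))) (by positivity)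
    fun c hc c' hc' hadm hpos => holder_part_le hS hL2 hm ha hk1 hkK hα0 hα1 hδ hCH hCM hH hM h1 hc hc' hadm hpos
  unfold normHGH norm132
  refine (add_le_add (add_le_add h₁ h₂) h₃).trans (le_of_eq ?_)
  ring

end Parts

/-! ## §8 (3.1) at a regular non-constant background on the torus -/

section Main

/-- weakening a decay rate. [folklore] -/
private theorem exp_rate_mono {δ δ' t : ℝ} (h : δ ≤ δ') (ht : 0 ≤ t) : Real.exp (-(δ' * t)) ≤ Real.exp (-(δ * t)) := by
  rw [Real.exp_le_exp]; nlinarith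

/-- **[B3] (3.1) p. 432 AT A REGULAR NON-CONSTANT BACKGROUND `B̃ = A` ON THE TORUS `Ω = T_η`, PROVED.**  For the (Higgs)₂,₃ torus
family (`d`, odd `L ≥ 3` fixed; volumes `P` with `S : Shape P`, `K₀ ∣ M`, `3K₀ ≤ 2M`, `K₀ ≥ K₀min`), `m² > 0`, `a > 0`, charge data `C`, every
`0 ≤ α < 1` has constants `t, δ₀, O(1) > 0` (depending on `K₀`; GAPS G-B3-11: the print's constants are uniform, here per `α` and `K₀`) such
that for every step `1 ≤ k ≤ K` with `L^kε ≤ 1` and every background `A` on `T_ε` regular in the sense (2.23)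
(`L^k·sup|∂A|·|e| ≤ t`): `‖hG_k(T_η,A)h′‖_{1,α} ≤ O(1)·e^{−δ₀dist(□(v),□(v′))}` for all unit cubes with `dist(□(v),□(v′)) ≥ 1` — the decl of
record `Sect3Data.Ineq31 α δ₀ O(1)` for the carrier `sect3RegTorus`.  Assembled from r14's (2.10) (`ineq210_regularTorus`), p26's (2.11)
(`ineq211At_regularTorus`) and the mixed clause of (2.10) (`ineq210_mixed_regularTorus`) through the pieces (2.6), with `δ₀ = δL/2`,
`δ = min` of the three rates. [cite: Balaban1983Higgs3, (3.1) p.432] [cite: Balaban1983Higgs3, (1.32) p.420] -/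
theorem ineq31_regularTorus (d L : ℕ) (hL : Odd L ∧ 1 < L) {a : ℝ} (ha : 0 < a) {msq : ℝ} (hmsq : 0 < msq)
    (N : ℕ) (C : ChargeData N) :
    ∃ K₀min : ℕ, ∀ {α : ℝ}, 0 ≤ α → α < 1 →
      ∃ t δ₀ Cst : ℕ → ℝ, (∀ K₀, 0 < t K₀ ∧ 0 < δ₀ K₀ ∧ 0 < Cst K₀) ∧
      ∀ K₀ : ℕ, K₀min ≤ K₀ →
      ∀ (P : HiggsLattice.Params) (S : Shape P), P.d = d → P.L = L → K₀ ∣ P.M → 3 * K₀ ≤ 2 * P.M →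
      ∀ {k : ℕ}, 1 ≤ k → k ≤ P.K → P.mesh k ≤ 1 →
      ∀ (A : HiggsLattice.VecField P 0) {δA : ℝ}, 0 ≤ δA →
        (∀ (z : HiggsLattice.Site P 0) (μ ν : Fin P.d), |A ⟨z.shift ν, μ⟩ - A ⟨z, μ⟩| ≤ δA) →
        (P.L : ℝ) ^ k * δA * |C.e| ≤ t K₀ →
        (sect3RegTorus S C A msq a k).Ineq31 α (δ₀ K₀) (Cst K₀) := by
  have hL2 : 2 ≤ L := hL.2
  have hL0 : (0 : ℝ) < L := by exact_mod_cast (by omega : 0 < L)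
  obtain ⟨K₁, t₁, δ₁, C₁, hpos₁, h210⟩ := ineq210_regularTorus d L hL ha hmsq N C
  obtain ⟨K₂, h211⟩ := ineq211At_regularTorus d L hL ha hmsq N C (a := a)
  obtain ⟨K₃, t₃, δ₃, C₃, hpos₃, hmix⟩ := ineq210_mixed_regularTorus d L hL ha hmsq N C
  refine ⟨max K₁ (max K₂ K₃), fun {α} hα0 hα1 => ?_⟩
  obtain ⟨t₂, δ₂, C₂, hpos₂, h211'⟩ := h211 hα0 hα1
  refine ⟨fun K₀ => min (t₁ K₀) (min (t₂ K₀) (t₃ K₀)), fun K₀ => min (δ₁ K₀) (min (δ₂ K₀) (δ₃ K₀)) * L / 2,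
    fun K₀ => (2 * C₁ K₀ + C₂ K₀ + d * C₃ K₀) * phiSum L (d + 1) (min (δ₁ K₀) (min (δ₂ K₀) (δ₃ K₀))), fun K₀ => ?_, ?_⟩
  · obtain ⟨ht₁, hδ₁, hC₁⟩ := hpos₁ K₀
    obtain ⟨ht₂, hδ₂, hC₂⟩ := hpos₂ K₀
    obtain ⟨ht₃, hδ₃, hC₃⟩ := hpos₃ K₀
    have hδ : 0 < min (δ₁ K₀) (min (δ₂ K₀) (δ₃ K₀)) := lt_min hδ₁ (lt_min hδ₂ hδ₃)
    have hΦ := phiSum_pos (L := L) (d + 1) hδ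
    exact ⟨lt_min ht₁ (lt_min ht₂ ht₃), by positivity, by positivity⟩
  intro K₀ hK₀ P S hPd hPL hK₀M h3M k hk1 hkK hmesh A δA hδA hreg ht
  obtain ⟨-, hδ₁, hC₁⟩ := hpos₁ K₀
  obtain ⟨-, hδ₂, hC₂⟩ := hpos₂ K₀
  obtain ⟨-, hδ₃, hC₃⟩ := hpos₃ K₀
  have hK₁ : K₁ ≤ K₀ := le_trans (le_max_left _ _) hK₀
  have hK₂ : K₂ ≤ K₀ := le_trans (le_trans (le_max_left _ _) (le_max_right _ _)) hK₀
  have hK₃ : K₃ ≤ K₀ := le_trans (le_trans (le_max_right _ _) (le_max_right _ _)) hK₀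
  have hI := h210 K₀ hK₁ P S hPd hPL hK₀M h3M hk1 hkK hmesh A hδA hreg (ht.trans (min_le_left _ _))
  have hHo := h211' K₀ hK₂ P S hPd hPL hK₀M h3M hk1 hkK hmesh A hδA hreg
    (ht.trans ((min_le_right _ _).trans (min_le_left _ _)))
  have hMi := hmix K₀ hK₃ P S hPd hPL hK₀M h3M hk1 hkK hmesh A hδA hreg
    (ht.trans ((min_le_right _ _).trans (min_le_right _ _)))
  subst hPd hPL
  -- the common rate
  obtain ⟨δ, hδdef⟩ : ∃ δ : ℝ, δ = min (δ₁ K₀) (min (δ₂ K₀) (δ₃ K₀)) := ⟨_, rfl⟩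
  beta_reduce
  rw [← hδdef]
  have hδ : 0 < δ := by rw [hδdef]; exact lt_min hδ₁ (lt_min hδ₂ hδ₃)
  have hle₁ : δ ≤ δ₁ K₀ := by rw [hδdef]; exact min_le_left _ _
  have hle₂ : δ ≤ δ₂ K₀ := by rw [hδdef]; exact (min_le_right _ _).trans (min_le_left _ _)
  have hle₃ : δ ≤ δ₃ K₀ := by rw [hδdef]; exact (min_le_right _ _).trans (min_le_right _ _)
  have hL2' : 2 ≤ P.L := hL2
  have hS : ∀ μ, 2 < P.sitesPerDir 0 μ := two_lt_sitesPerDir (hk1.trans hkK) hL2'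
  -- the four inputs in model form with the common rate
  have hV : ∀ (j : ℕ) (x x' : HiggsLattice.Site P 0),
      (P.mesh 0 ^ P.d)⁻¹ * ∑ i' : Ix N, ‖pieceA C A msq a k j (cb P N 0 (x', i')) x‖
        ≤ C₁ K₀ * (P.mesh j ^ 2 * (P.mesh j ^ P.d)⁻¹) * Real.exp (-(δ * ((HiggsLattice.Site.tdist x x' : ℝ) / (P.L : ℝ) ^ j))) := by
    intro j x x'
    have := P.mesh_pos j
    exact (bounds_of_ineq210 hI j x x').1.trans
      (mul_le_mul_of_nonneg_left (exp_rate_mono hle₁ (by positivity)) (by positivity))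
  have hDv : ∀ (j : ℕ) (μ : Fin P.d) (x x' : HiggsLattice.Site P 0),
      (P.mesh 0 ^ P.d)⁻¹ * ∑ i' : Ix N, ‖covDeriv C A (pieceA C A msq a k j (cb P N 0 (x', i'))) ⟨x, μ⟩‖
        ≤ C₁ K₀ * (P.mesh j * (P.mesh j ^ P.d)⁻¹) * Real.exp (-(δ * ((HiggsLattice.Site.tdist x x' : ℝ) / (P.L : ℝ) ^ j))) := by
    intro j μ x x'
    have := P.mesh_pos j
    exact ((bounds_of_ineq210 hI j x x').2 μ).trans
      (mul_le_mul_of_nonneg_left (exp_rate_mono hle₁ (by positivity)) (by positivity))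
  have hH : ∀ (j : ℕ) (μ : Fin P.d) (x₁ x₂ x : HiggsLattice.Site P 0) (Γ : List (HiggsLattice.Site P 0)), x₁ ≠ x₂ →
      IsAdm x₁ x₂ Γ →
      holderTerm C A msq a k j μ x₁ x₂ x Γ
        ≤ (P.mesh 0 * (HiggsLattice.Site.tdist x₁ x₂ : ℝ)) ^ α *
          (C₂ K₀ * (P.mesh j * (P.mesh j ^ P.d)⁻¹ * (P.mesh j ^ α)⁻¹) *
            Real.exp (-(δ * (min (HiggsLattice.Site.tdist x₁ x : ℝ) (HiggsLattice.Site.tdist x₂ x : ℝ) / (P.L : ℝ) ^ j)))) := by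
    intro j μ x₁ x₂ x Γ hne hΓ
    have := P.mesh_pos j
    have := P.mesh_pos 0
    refine (bound_of_ineq211At hHo j μ hne x hΓ).trans (mul_le_mul_of_nonneg_left
      (mul_le_mul_of_nonneg_left (exp_rate_mono hle₂ (by positivity)) (by positivity)) (by positivity))
  have hM : ∀ (j : ℕ) (μ ν : Fin P.d) (x x' : HiggsLattice.Site P 0),
      mixedTerm C A msq a k j μ ν x x'
        ≤ C₃ K₀ * (P.mesh j ^ P.d)⁻¹ * Real.exp (-(δ * ((HiggsLattice.Site.tdist x x' : ℝ) / (P.L : ℝ) ^ j))) := by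
    intro j μ ν x x'
    have := P.mesh_pos j
    exact (hMi j μ ν x x').trans (mul_le_mul_of_nonneg_left (exp_rate_mono hle₃ (by positivity)) (by positivity))
  rw [ineq31_iff]
  intro v v' h1
  exact normHGH_le hS hL2' hmsq.le ha hk1 hkK hα0 hα1.le hδ hC₁.le hC₂.le hC₃.le hV hDv hH hM h1

end Main

end Literature.MathematicalPhysics.QuantumFieldTheory.Balaban1983to89.B3Ineq31RegularTorus

end
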